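import Literature.NumberTheory.Automorphic.ArchKirillovShapeTypesGL2
import Literature.NumberTheory.Automorphic.ArchKirillovInjectiveKFinite
import Literature.NumberTheory.Automorphic.ArchKirillovFactorisationGL2
import Literature.NumberTheory.Automorphic.KirillovShapeMellinGL2
import Literature.NumberTheory.Automorphic.ArchKTypeWeightVector
import HarnessLib

/-!
# Construction of the archimedean Hecke test vector for `GL₂(K_∞)`
# (Jacquet–Langlands (1970), §5 Thm. 5.15, §6 Thm. 6.4, proof of Thm. 11.1)

Topic `NumberTheory/Automorphic`; namespace `Literature.NumberTheory.Automorphic`. `Prop`-valued structures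
(raw and final place data of a `K_∞`-finite vector) and theorems; no named fact, no instance.

From the normal form of the base vector (`ArchKirillovBaseVectorNormalFormGL2`) and the injectivity of the
Kirillov map on `K_∞`-finite vectors (`ArchKirillovInjectiveKFinite`) we construct a `K_∞`-finite Gårding vector
`e₀` which at every archimedean place is of one of the SHAPE TYPES of `ArchKirillovShapeTypesGL2`, deduce the
factorisation of its Kirillov function and of the Kirillov function of `τ(w) e₀` twisted by the central
character, and compute both Mellin transforms as Gamma products (`KirillovShapeMellinGL2`). The end result is
hypothesis `(A∞)` of `StandardLTheoryGL2OfArchTestVectorAndEulerFactorisationIntegrable`.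

## References

* H. Jacquet, R. P. Langlands, *Automorphic Forms on GL(2)*, LNM 114 (1970), §5 (Thm. 5.13, 5.15), §6
  (Thm. 6.2–6.4), §11 (proof of Thm. 11.1). [JacquetLanglands1970]
* A. W. Knapp, *Representation Theory of Semisimple Groups* (1986), Ch. VIII §3. [Knapp1986]
-/

noncomputable section

open MeasureTheory Measure NumberField NumberField.InfinitePlace NumberField.mixedEmbedding IsDedekindDomain Set Filter
open scoped MatrixGroups Topology Classical InnerProductSpace

namespace Literature.NumberTheory.Automorphic

variable {K : Type} [Field K] [NumberField K]

-- as in `ArchGardingWhittaker`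
set_option backward.isDefEq.respectTransparency false

/-! ### 1. Preliminaries: injectivity on `K_∞`-finite vectors, scalars -/

section Prelim

variable {hcpt : isCompact_glFiniteIntegralLevel 2 K}
  {E : Type*} [NormedAddCommGroup E] [InnerProductSpace ℂ E] [CompleteSpace E]
  {τ : ContRepresentation ℂ (AutomorphyDatum.gl 2 K hcpt).arch.carrier E}
  (hτ : τ.IsStronglyContinuous)

local notation "D" => gardingEnd (hcpt := hcpt) (τ := τ) hτ

/-- **A `K_∞`-finite vector in the null space of the Kirillov map is zero**
(`ArchKirillovInjectiveKFinite.eq_zero_of_kFinite_of_mem_kirillovNull`). [cite: JacquetLanglands1970, §5–§6] -/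
theorem eq_zero_of_mem_archKFinite_of_mem_kirillovNull (hτu : τ.IsUnitary) (hτi : τ.IsTopIrreducible)
    {ℓ : archGardingSpace hcpt τ →ₗ[ℂ] ℂ} (hℓW : IsArchContWhittakerFunctional hcpt τ hτ ℓ) (hne : ℓ ≠ 0)
    {v : archGardingSpace hcpt τ} (hv : v ∈ archKFinite hτ) (hvS : v ∈ kirillovNull hτ ℓ) : v = 0 := by
  obtain ⟨V, hVfd, hK, hvV⟩ := (mem_archKFinite_iff hτ).mp hv
  haveI := hVfd
  exact eq_zero_of_kFinite_of_mem_kirillovNull hτ hτu hτi hℓW hne hK hvV hvS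

/-- A non-zero `K_∞`-finite vector is not in the null space. [folklore] -/
theorem not_mem_kirillovNull_of_mem_archKFinite (hτu : τ.IsUnitary) (hτi : τ.IsTopIrreducible)
    {ℓ : archGardingSpace hcpt τ →ₗ[ℂ] ℂ} (hℓW : IsArchContWhittakerFunctional hcpt τ hτ ℓ) (hne : ℓ ≠ 0)
    {v : archGardingSpace hcpt τ} (hv : v ∈ archKFinite hτ) (hv0 : v ≠ 0) : v ∉ kirillovNull hτ ℓ :=
  fun h => hv0 (eq_zero_of_mem_archKFinite_of_mem_kirillovNull hτ hτu hτi hℓW hne hv h)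

/-- The central scalar of a real place: `τ(H₀) + τ(H₁) = μ_w`. [cite: Knapp1986, Ch. VIII §3] -/
theorem exists_realCentral (hτu : τ.IsUnitary) (hτi : τ.IsTopIrreducible) (w : {w : InfinitePlace K // IsReal w}) :
    ∃ μ : ℂ, ∀ v : archGardingSpace hcpt τ,
      D (Matrix.single 0 0 ((Pi.single w 1, 0) : mixedSpace K)) v + D (Matrix.single 1 1 ((Pi.single w 1, 0) : mixedSpace K)) v = μ • v := by
  obtain ⟨μ, hμ⟩ := exists_gardingEnd_smul_one_eq_smul hτ hτu hτi ((Pi.single w 1, 0) : mixedSpace K)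
  exact ⟨μ, fun v => by rw [← LinearMap.add_apply, ← gardingEnd_add, ← smul_one_eq_single_add_single, hμ]⟩

/-- The central scalars of a complex place: `τ(E₀₀⊗c + E₁₁⊗c) = μ₁`, `τ(Z^I) = μ₂`. [cite: Knapp1986, Ch. VIII §3] -/
theorem exists_complexCentral (hτu : τ.IsUnitary) (hτi : τ.IsTopIrreducible) (w : {w : InfinitePlace K // IsComplex w}) :
    (∃ μ₁ : ℂ, ∀ v : archGardingSpace hcpt τ,
      D (Matrix.single 0 0 ((0, Pi.single w 1) : mixedSpace K) + Matrix.single 1 1 ((0, Pi.single w 1) : mixedSpace K)) v = μ₁ • v) ∧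
    ∃ μ₂ : ℂ, ∀ v : archGardingSpace hcpt τ,
      D (Matrix.single 0 0 ((0, Pi.single w Complex.I) : mixedSpace K) + Matrix.single 1 1 ((0, Pi.single w Complex.I) : mixedSpace K)) v = μ₂ • v := by
  refine ⟨?_, ?_⟩
  · obtain ⟨μ, hμ⟩ := exists_gardingEnd_smul_one_eq_smul hτ hτu hτi ((0, Pi.single w 1) : mixedSpace K)
    exact ⟨μ, fun v => by rw [← smul_one_eq_single_add_single, hμ]⟩
  · obtain ⟨μ, hμ⟩ := exists_gardingEnd_smul_one_eq_smul hτ hτu hτi ((0, Pi.single w Complex.I) : mixedSpace K)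
    exact ⟨μ, fun v => by rw [← smul_one_eq_single_add_single, hμ]⟩

/-- `archKFinite` is stable under linear combinations of products of the `τ(X)`: the descent operator.
[folklore] -/
theorem descentOp_mem_archKFinite (w : {w : InfinitePlace K // IsComplex w}) (mc : ℂ) {v : archGardingSpace hcpt τ}
    (hv : v ∈ archKFinite hτ) : descentOp hτ w mc v ∈ archKFinite hτ := by
  have hD : ∀ (X : Matrix (Fin 2) (Fin 2) (mixedSpace K)) {u : archGardingSpace hcpt τ}, u ∈ archKFinite hτ → D X u ∈ archKFinite hτ :=
    fun X u hu => gardingEnd_mem_archKFinite hτ X hu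
  have hh : ∀ (i j : Fin 2) {u : archGardingSpace hcpt τ}, u ∈ archKFinite hτ →
      (D (Matrix.single i j ((0, Pi.single w 1) : mixedSpace K)) - Complex.I • D (Matrix.single i j ((0, Pi.single w Complex.I) : mixedSpace K))) u ∈ archKFinite hτ :=
    fun i j u hu => by
      rw [LinearMap.sub_apply, LinearMap.smul_apply]
      exact Submodule.sub_mem _ (hD _ hu) (Submodule.smul_mem _ _ (hD _ hu))
  have ha : ∀ (i j : Fin 2) {u : archGardingSpace hcpt τ}, u ∈ archKFinite hτ →
      (D (Matrix.single i j ((0, Pi.single w 1) : mixedSpace K)) + Complex.I • D (Matrix.single i j ((0, Pi.single w Complex.I) : mixedSpace K))) u ∈ archKFinite hτ :=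
    fun i j u hu => by
      rw [LinearMap.add_apply, LinearMap.smul_apply]
      exact Submodule.add_mem _ (hD _ hu) (Submodule.smul_mem _ _ (hD _ hu))
  have hF : ∀ {u : archGardingSpace hcpt τ}, u ∈ archKFinite hτ →
      ((D (Matrix.single 1 0 ((0, Pi.single w 1) : mixedSpace K)) - Complex.I • D (Matrix.single 1 0 ((0, Pi.single w Complex.I) : mixedSpace K))) -
        (D (Matrix.single 0 1 ((0, Pi.single w 1) : mixedSpace K)) + Complex.I • D (Matrix.single 0 1 ((0, Pi.single w Complex.I) : mixedSpace K)))) u ∈ archKFinite hτ :=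
    fun {u} hu => by rw [LinearMap.sub_apply]; exact Submodule.sub_mem _ (hh 1 0 hu) (ha 0 1 hu)
  rw [descentOp_apply]
  refine Submodule.sub_mem _ (Submodule.sub_mem _ ?_ (Submodule.smul_mem _ _ ?_)) (Submodule.smul_mem _ _ ?_)
  · rw [LinearMap.add_apply]; exact Submodule.add_mem _ (hh 1 0 hv) (ha 0 1 hv)
  · rw [LinearMap.add_apply, LinearMap.smul_apply, LinearMap.smul_apply, LinearMap.sub_apply, LinearMap.sub_apply]
    exact Submodule.add_mem _ (Submodule.smul_mem _ _ (Submodule.sub_mem _ (hh 0 0 (hF hv)) (hh 1 1 (hF hv))))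
      (Submodule.smul_mem _ _ (Submodule.sub_mem _ (ha 0 0 (hF hv)) (ha 1 1 (hF hv))))
  · rw [LinearMap.add_apply]
    exact Submodule.add_mem _ (hh 0 1 (hF (hF hv))) (ha 1 0 (hF (hF hv)))

end Prelim

/-! ### 2. Stability of `archKFinite` under generated subalgebras; the kernel criterion -/

section Adjoin

variable {hcpt : isCompact_glFiniteIntegralLevel 2 K}
  {E : Type*} [NormedAddCommGroup E] [InnerProductSpace ℂ E] [CompleteSpace E]
  {τ : ContRepresentation ℂ (AutomorphyDatum.gl 2 K hcpt).arch.carrier E}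
  (hτ : τ.IsStronglyContinuous)

omit [CompleteSpace E] in
/-- A submodule stable under a set of operators is stable under the subalgebra they generate. [folklore] -/
theorem mem_of_mem_adjoin {N : Submodule ℂ (archGardingSpace hcpt τ)} {S : Set (Module.End ℂ (archGardingSpace hcpt τ))}
    (hS : ∀ T ∈ S, ∀ u ∈ N, T u ∈ N) {M : Module.End ℂ (archGardingSpace hcpt τ)} (hM : M ∈ Algebra.adjoin ℂ S)
    {u : archGardingSpace hcpt τ} (hu : u ∈ N) : M u ∈ N := by
  induction hM using Algebra.adjoin_induction generalizing u with
  | mem T hT => exact hS T hT u hu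
  | algebraMap c => rw [Module.algebraMap_end_apply]; exact N.smul_mem c hu
  | add T₁ T₂ _ _ ih₁ ih₂ => rw [LinearMap.add_apply]; exact N.add_mem (ih₁ hu) (ih₂ hu)
  | mul T₁ T₂ _ _ ih₁ ih₂ => rw [Module.End.mul_apply]; exact ih₁ (ih₂ hu)

omit [CompleteSpace E] in
/-- An operator commuting with a set of operators commutes with the subalgebra they generate. [folklore] -/
theorem commute_of_mem_adjoin {S : Set (Module.End ℂ (archGardingSpace hcpt τ))} {Φ : Module.End ℂ (archGardingSpace hcpt τ)}
    (hS : ∀ T ∈ S, Commute Φ T) {M : Module.End ℂ (archGardingSpace hcpt τ)} (hM : M ∈ Algebra.adjoin ℂ S) : Commute Φ M :=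
  Algebra.commute_of_mem_adjoin_of_forall_mem_commute hM hS

variable {ℓ : archGardingSpace hcpt τ →ₗ[ℂ] ℂ}

/-- **`τ(E₀₁ ⊗ x)` multiplies the Kirillov function by `dψ_∞(E₀₁ ⊗ ux)`.** [cite: JacquetLanglands1970, §5 Lemma 5.13.1] -/
theorem kirillovFn_gardingEnd_single_zero_one (hℓW : IsArchContWhittakerFunctional hcpt τ hτ ℓ) (x : mixedSpace K)
    (v : archGardingSpace hcpt τ) (u : (mixedSpace K)ˣ) :
    kirillovFn hτ ℓ (gardingEnd hτ (Matrix.single 0 1 x) v) u =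
      archWhittakerDChar K (0 : Fin 2) 1 ((u : mixedSpace K) * x) * kirillovFn hτ ℓ v u := by
  rw [kirillovFn_eq_apply_gardingAct, kirillovFn_eq_apply_gardingAct, apply_gardingAct_diagGL2_gardingEnd_single_zero_one hτ hℓW]

/-- If `τ(E₀₁ ⊗ x) v ∈ S_ℓ` and `dψ_∞(E₀₁ ⊗ ux) ≠ 0` for all `u`, then `v ∈ S_ℓ`. [folklore] -/
theorem mem_kirillovNull_of_gardingEnd_single_zero_one_mem (hℓW : IsArchContWhittakerFunctional hcpt τ hτ ℓ) {x : mixedSpace K}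
    (hx : ∀ u : (mixedSpace K)ˣ, archWhittakerDChar K (0 : Fin 2) 1 ((u : mixedSpace K) * x) ≠ 0)
    {v : archGardingSpace hcpt τ} (hv : gardingEnd hτ (Matrix.single 0 1 x) v ∈ kirillovNull hτ ℓ) : v ∈ kirillovNull hτ ℓ := by
  intro u
  have h := hv u
  rw [kirillovFn_gardingEnd_single_zero_one hτ hℓW] at h
  exact (mul_eq_zero.mp h).resolve_left (hx u)

/-- The holomorphic letter `τ^h(E₀₁)`: `v ∈ S_ℓ` if `τ^h(E₀₁) v ∈ S_ℓ`. [folklore] -/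
theorem mem_kirillovNull_of_hol01_mem (hℓW : IsArchContWhittakerFunctional hcpt τ hτ ℓ) (w : {w : InfinitePlace K // IsComplex w})
    {v : archGardingSpace hcpt τ}
    (hv : (gardingEnd hτ (Matrix.single 0 1 ((0, Pi.single w 1) : mixedSpace K)) -
      Complex.I • gardingEnd hτ (Matrix.single 0 1 ((0, Pi.single w Complex.I) : mixedSpace K))) v ∈ kirillovNull hτ ℓ) :
    v ∈ kirillovNull hτ ℓ := by
  intro u
  have h := hv u
  rw [kirillovFn_eq_apply_gardingAct, LinearMap.sub_apply, LinearMap.smul_apply, map_sub, map_smul, map_sub, map_smul, smul_eq_mul,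
    apply_gardingAct_diagGL2_gardingEnd_single_zero_one hτ hℓW, apply_gardingAct_diagGL2_gardingEnd_single_zero_one hτ hℓW,
    ← kirillovFn_eq_apply_gardingAct, ← mul_assoc, ← sub_mul] at h
  exact (mul_eq_zero.mp h).resolve_left (archWhittakerDChar_hol u w).2

/-- The antiholomorphic letter `τ^a(E₀₁)`: `v ∈ S_ℓ` if `τ^a(E₀₁) v ∈ S_ℓ`. [folklore] -/
theorem mem_kirillovNull_of_anti01_mem (hℓW : IsArchContWhittakerFunctional hcpt τ hτ ℓ) (w : {w : InfinitePlace K // IsComplex w})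
    {v : archGardingSpace hcpt τ}
    (hv : (gardingEnd hτ (Matrix.single 0 1 ((0, Pi.single w 1) : mixedSpace K)) +
      Complex.I • gardingEnd hτ (Matrix.single 0 1 ((0, Pi.single w Complex.I) : mixedSpace K))) v ∈ kirillovNull hτ ℓ) :
    v ∈ kirillovNull hτ ℓ := by
  intro u
  have h := hv u
  rw [kirillovFn_eq_apply_gardingAct, LinearMap.add_apply, LinearMap.smul_apply, map_add, map_smul, map_add, map_smul, smul_eq_mul,
    apply_gardingAct_diagGL2_gardingEnd_single_zero_one hτ hℓW, apply_gardingAct_diagGL2_gardingEnd_single_zero_one hτ hℓW,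
    ← kirillovFn_eq_apply_gardingAct, ← mul_assoc, ← add_mul] at h
  exact (mul_eq_zero.mp h).resolve_left (archWhittakerDChar_anti u w).2

/-- Powers: `v ∈ S_ℓ` if `T^b v ∈ S_ℓ` whenever `T` has this property. [folklore] -/
theorem mem_kirillovNull_of_pow_mem {T : Module.End ℂ (archGardingSpace hcpt τ)}
    (hT : ∀ v : archGardingSpace hcpt τ, T v ∈ kirillovNull hτ ℓ → v ∈ kirillovNull hτ ℓ) (b : ℕ)
    {v : archGardingSpace hcpt τ} (hv : (T ^ b) v ∈ kirillovNull hτ ℓ) : v ∈ kirillovNull hτ ℓ := by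
  induction b generalizing v with
  | zero => simpa using hv
  | succ b ih =>
    rw [pow_succ, Module.End.mul_apply] at hv
    exact hT _ (ih hv)

end Adjoin

/-! ### 3. Real places: raw data, final data, the modification step -/

section RealPlace

variable {hcpt : isCompact_glFiniteIntegralLevel 2 K}
  {E : Type*} [NormedAddCommGroup E] [InnerProductSpace ℂ E] [CompleteSpace E]
  {τ : ContRepresentation ℂ (AutomorphyDatum.gl 2 K hcpt).arch.carrier E}
  (hτ : τ.IsStronglyContinuous) (w : {w : InfinitePlace K // IsReal w})

local notation "H₀" => Matrix.single (0 : Fin 2) (0 : Fin 2) ((Pi.single w 1, 0) : mixedSpace K)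
local notation "H₁" => Matrix.single (1 : Fin 2) (1 : Fin 2) ((Pi.single w 1, 0) : mixedSpace K)
local notation "X⁺" => Matrix.single (0 : Fin 2) (1 : Fin 2) ((Pi.single w 1, 0) : mixedSpace K)
local notation "X⁻" => Matrix.single (1 : Fin 2) (0 : Fin 2) ((Pi.single w 1, 0) : mixedSpace K)
local notation "D" => gardingEnd (hcpt := hcpt) (τ := τ) hτ
local notation "Lo" => (gardingEnd (hcpt := hcpt) (τ := τ) hτ (H₀ - H₁) - Complex.I • gardingEnd (hcpt := hcpt) (τ := τ) hτ (X⁺ + X⁻))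
local notation "Ra" => (gardingEnd (hcpt := hcpt) (τ := τ) hτ (H₀ - H₁) + Complex.I • gardingEnd (hcpt := hcpt) (τ := τ) hτ (X⁺ + X⁻))

variable (δ : GL (Fin 2) (mixedSpace K))

/-- **Raw data of the base vector at a real place** (from the normal form): weight `k ≥ 0`; for `k = 0` a
`τ(δ_w)`-sign; for `k ≥ 1` either `L_w v = 0` or (`k = 1` and the scalar `R_w L_w = s_w` is non-zero).
[cite: JacquetLanglands1970, §5 Thm. 5.13] -/
structure RealRaw (v : archGardingSpace hcpt τ) (k : ℕ) (sR : ℂ) : Prop where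
  weyl : D (X⁺ - X⁻) v = (Complex.I * k) • v
  sign : k = 0 → gardingAct hτ δ v = v ∨ gardingAct hτ δ v = -v
  low : 1 ≤ k → Lo v = 0 ∨ (k = 1 ∧ sR ≠ 0)

/-- **Final data at a real place**: one of the four `τ(δ_w)`-even shape types. [cite: JacquetLanglands1970, §5 Thm. 5.15] -/
def RealFinal (μ lam : ℂ) (v : archGardingSpace hcpt τ) : Prop :=
  (∃ k : ℕ, 1 ≤ k ∧ RealDiscPlus hτ w v k μ) ∨ (∃ κ : ℂ, RealWeightOneSym hτ w δ v 1 κ μ lam) ∨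
    RealWeightZero hτ w δ v 1 μ lam ∨ RealWeightZeroX hτ w δ v 1 μ lam

/-- The generators of the place: the four letters and `τ(δ_w)`. [folklore] -/
def realPlaceGens : Set (Module.End ℂ (archGardingSpace hcpt τ)) :=
  Set.range (fun p : Fin 2 × Fin 2 => D (Matrix.single p.1 p.2 ((Pi.single w 1, 0) : mixedSpace K))) ∪ {gardingAct hτ δ}

variable {hτ w δ}

/-- Transport of the raw data. [folklore] -/
theorem RealRaw.map {Φ : Module.End ℂ (archGardingSpace hcpt τ)}
    (hΦ : ∀ i j : Fin 2, Commute Φ (gardingEnd hτ (Matrix.single i j ((Pi.single w 1, 0) : mixedSpace K))))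
    (hΦδ : Commute Φ (gardingAct hτ δ)) {v : archGardingSpace hcpt τ} {k : ℕ} {sR : ℂ} (h : RealRaw hτ w δ v k sR) :
    RealRaw hτ w δ (Φ v) k sR := by
  obtain ⟨hW, -, -, -⟩ := commute_realPlace_ops w hΦ
  obtain ⟨-, hLo, -⟩ := commute_weylR_lowering_raising hτ w hΦ
  refine ⟨?_, fun hk => ?_, fun hk => ?_⟩
  · rw [← Module.End.mul_apply, ← hW.eq, Module.End.mul_apply, h.weyl, map_smul]
  · rcases h.sign hk with h1 | h1
    · left; rw [← Module.End.mul_apply, ← hΦδ.eq, Module.End.mul_apply, h1]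
    · right; rw [← Module.End.mul_apply, ← hΦδ.eq, Module.End.mul_apply, h1, map_neg]
  · rcases h.low hk with h1 | h1
    · left; rw [← Module.End.mul_apply, ← hLo.eq, Module.End.mul_apply, h1, map_zero]
    · exact Or.inr h1

/-- Transport of the final data. [folklore] -/
theorem RealFinal.map {Φ : Module.End ℂ (archGardingSpace hcpt τ)}
    (hΦ : ∀ i j : Fin 2, Commute Φ (gardingEnd hτ (Matrix.single i j ((Pi.single w 1, 0) : mixedSpace K))))
    (hΦδ : Commute Φ (gardingAct hτ δ)) {μ lam : ℂ} {v : archGardingSpace hcpt τ} (h : RealFinal hτ w δ μ lam v) :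
    RealFinal hτ w δ μ lam (Φ v) := by
  rcases h with ⟨k, hk, h⟩ | ⟨κ, h⟩ | h | h
  · exact Or.inl ⟨k, hk, h.map w hΦ⟩
  · exact Or.inr (Or.inl ⟨κ, h.map w hΦ hΦδ⟩)
  · exact Or.inr (Or.inr (Or.inl (h.map w hΦ hΦδ)))
  · exact Or.inr (Or.inr (Or.inr (h.map w hΦ hΦδ)))

/-- An operator commuting with the generators of the place commutes with the generated subalgebra and
transports raw and final data. [folklore] -/
theorem commute_realPlaceGens_iff {Φ : Module.End ℂ (archGardingSpace hcpt τ)} :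
    (∀ T ∈ realPlaceGens hτ w δ, Commute Φ T) ↔
      (∀ i j : Fin 2, Commute Φ (gardingEnd hτ (Matrix.single i j ((Pi.single w 1, 0) : mixedSpace K)))) ∧ Commute Φ (gardingAct hτ δ) := by
  constructor
  · intro h
    exact ⟨fun i j => h _ (Or.inl ⟨(i, j), rfl⟩), h _ (Or.inr rfl)⟩
  · rintro ⟨h1, h2⟩ T (⟨p, rfl⟩ | hT)
    · exact h1 p.1 p.2
    · rw [Set.mem_singleton_iff.mp hT]; exact h2

variable (hδ : (δ : Matrix (Fin 2) (Fin 2) (mixedSpace K)) = 1 - (2 : ℝ) • Matrix.single (0 : Fin 2) (0 : Fin 2) ((Pi.single w 1, 0) : mixedSpace K))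

include hδ in
/-- The generated subalgebra preserves `archKFinite`. [folklore] -/
theorem realPlaceGens_mem_archKFinite : ∀ T ∈ realPlaceGens hτ w δ, ∀ u ∈ archKFinite hτ, T u ∈ archKFinite hτ := by
  rintro T (⟨p, rfl⟩ | hT) u hu
  · exact gardingEnd_mem_archKFinite hτ _ hu
  · rw [Set.mem_singleton_iff.mp hT]
    exact gardingAct_mem_archKFinite hτ (realSign_mem_Kinf hδ) hu

/-- The letters and `τ(δ_w)` lie in the generated subalgebra; so do `L_w` and `τ(X⁺+X⁻)`. [folklore] -/
theorem mem_adjoin_realPlaceGens :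
    (∀ i j : Fin 2, D (Matrix.single i j ((Pi.single w 1, 0) : mixedSpace K)) ∈ Algebra.adjoin ℂ (realPlaceGens hτ w δ)) ∧
    gardingAct hτ δ ∈ Algebra.adjoin ℂ (realPlaceGens hτ w δ) ∧
    (Lo : Module.End ℂ (archGardingSpace hcpt τ)) ∈ Algebra.adjoin ℂ (realPlaceGens hτ w δ) ∧
    D (X⁺ + X⁻) ∈ Algebra.adjoin ℂ (realPlaceGens hτ w δ) := by
  have h1 : ∀ i j : Fin 2, D (Matrix.single i j ((Pi.single w 1, 0) : mixedSpace K)) ∈ Algebra.adjoin ℂ (realPlaceGens hτ w δ) :=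
    fun i j => Algebra.subset_adjoin (Or.inl ⟨(i, j), rfl⟩)
  have hX : D (X⁺ + X⁻) ∈ Algebra.adjoin ℂ (realPlaceGens hτ w δ) := by
    rw [gardingEnd_add]; exact Subalgebra.add_mem _ (h1 0 1) (h1 1 0)
  refine ⟨h1, Algebra.subset_adjoin (Or.inr rfl), ?_, hX⟩
  rw [gardingEnd_sub]
  exact Subalgebra.sub_mem _ (Subalgebra.sub_mem _ (h1 0 0) (h1 1 1)) (Subalgebra.smul_mem _ hX _)

variable (hτu : τ.IsUnitary) (hτi : τ.IsTopIrreducible) {ℓ : archGardingSpace hcpt τ →ₗ[ℂ] ℂ}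
  (hℓW : IsArchContWhittakerFunctional hcpt τ hτ ℓ) (hne : ℓ ≠ 0)
include hδ hτu hτi hℓW hne

omit hτu hτi hℓW hne in
/-- A non-zero vector of weight `1` is not killed by `1 + τ(δ_w)`. [folklore] -/
theorem add_gardingAct_realSign_ne_zero_of_weightOne {y : archGardingSpace hcpt τ} (hy0 : y ≠ 0)
    (hW : D (X⁺ - X⁻) y = Complex.I • y) : y + gardingAct hτ δ y ≠ 0 := by
  intro h
  have hδy : gardingAct hτ δ y = -y := eq_neg_of_add_eq_zero_right h
  have h1 := realSign_weight hτ hδ (k := 1) (v := y) (by rw [mul_one]; exact hW)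
  rw [hδy, map_neg, hW, smul_neg, ← neg_smul, ← neg_smul, ← sub_eq_zero, ← sub_smul, smul_eq_zero] at h1
  rcases h1 with h1 | h1
  · have h2 : -Complex.I - -(Complex.I * -1) = -(2 * Complex.I) := by ring
    rw [h2] at h1
    exact mul_ne_zero two_ne_zero Complex.I_ne_zero (neg_eq_zero.mp h1)
  · exact hy0 h1

/-- **The modification step at a real place**: from a non-zero `K_∞`-finite vector with raw data, an operator
`M` in the subalgebra of the place with `M y` non-zero, `K_∞`-finite and of a final type (`M = 1` for the
discrete and even weight-zero types, `τ(X⁺+X⁻)` for the odd weight-zero type, the symmetrisation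
`(1 + τ(δ))(1 ± (2κ₀)⁻¹ L)` with the sign making it non-zero for weight one). [cite: JacquetLanglands1970, §5 Thm. 5.15] -/
theorem realStep {μ lam sR : ℂ} (hμ : ∀ v : archGardingSpace hcpt τ, D H₀ v + D H₁ v = μ • v)
    (hlam : ∀ v : archGardingSpace hcpt τ, ∑ i : Fin 2, ∑ j : Fin 2, D (Matrix.single i j ((Pi.single w 1, 0) : mixedSpace K))
      (D (Matrix.single j i ((Pi.single w 1, 0) : mixedSpace K)) v) = lam • v)
    (hsR : sR = 2 * lam - μ ^ 2 + 1)
    {y : archGardingSpace hcpt τ} (hy : y ∈ archKFinite hτ) (hy0 : y ≠ 0) {k : ℕ} (hraw : RealRaw hτ w δ y k sR) :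
    ∃ M : Module.End ℂ (archGardingSpace hcpt τ), M ∈ Algebra.adjoin ℂ (realPlaceGens hτ w δ) ∧
      M y ∈ archKFinite hτ ∧ M y ≠ 0 ∧ RealFinal hτ w δ μ lam (M y) := by
  obtain ⟨hD, hδm, hLo, hX⟩ := mem_adjoin_realPlaceGens (hτ := hτ) (w := w) (δ := δ)
  have hKf : ∀ {M : Module.End ℂ (archGardingSpace hcpt τ)}, M ∈ Algebra.adjoin ℂ (realPlaceGens hτ w δ) → M y ∈ archKFinite hτ :=
    fun hM => mem_of_mem_adjoin (realPlaceGens_mem_archKFinite hδ) hM hy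
  rcases Nat.eq_zero_or_pos k with hk | hk
  · -- weight zero
    subst hk
    have hW0 : D (X⁺ - X⁻) y = 0 := by rw [hraw.weyl]; simp
    rcases hraw.sign rfl with hs | hs
    · refine ⟨1, Subalgebra.one_mem _, by simpa using hy, by simpa using hy0, Or.inr (Or.inr (Or.inl ⟨Or.inl rfl, ?_, hμ y, hlam y, ?_⟩))⟩
      · simpa using hW0
      · simpa using hs
    · refine ⟨D (X⁺ + X⁻), hX, hKf hX, ?_, Or.inr (Or.inr (Or.inr ⟨Or.inl rfl, y, hW0, hμ y, hlam y, by rw [hs, neg_one_smul], rfl⟩))⟩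
      -- `τ(X⁺+X⁻) y = 2 τ(X⁺) y` is non-zero as `y ∉ S_ℓ`
      intro h0
      have hθ : ∀ u : archGardingSpace hcpt τ, ℓ (D X⁺ u) = archWhittakerDChar K (0 : Fin 2) 1 ((Pi.single w 1, 0) : mixedSpace K) * ℓ u :=
        fun u => apply_gardingEnd_single_zero_one hτ hℓW _ u
      have h2 := (apply_gardingAct_expGL_xSum_of_weightZero hτ w hθ y hW0 0).1
      rw [h0] at h2
      have h3 : D X⁺ y = 0 := by
        have := (smul_eq_zero.mp h2.symm).resolve_left two_ne_zero
        exact this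
      have hyS : y ∈ kirillovNull hτ ℓ :=
        mem_kirillovNull_of_gardingEnd_single_zero_one_mem hτ hℓW (fun u => (archWhittakerDChar_mul_realIdem u w).2)
          (by rw [h3]; exact Submodule.zero_mem _)
      exact not_mem_kirillovNull_of_mem_archKFinite hτ hτu hτi hℓW hne hy hy0 hyS
  · rcases hraw.low hk with hL | ⟨hk1, hs⟩
    · -- discrete type
      exact ⟨1, Subalgebra.one_mem _, by simpa using hy, by simpa using hy0, Or.inl ⟨k, hk, by simpa using hraw.weyl, by simpa using hμ y, by simpa using hL⟩⟩
    · -- weight one, `s_w ≠ 0`: the symmetrised combination with the good sign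
      subst hk1
      have hW1 : D (X⁺ - X⁻) y = Complex.I • y := by rw [hraw.weyl]; simp
      set κ₀ : ℂ := sR ^ (((2 : ℕ) : ℂ)⁻¹) / 2 with hκ₀
      have hκsq : (2 * κ₀) ^ 2 = 2 * lam - μ ^ 2 + 1 := by
        rw [hκ₀, mul_div_cancel₀ _ two_ne_zero, ← hsR]
        exact Complex.cpow_nat_inv_pow sR two_ne_zero
      have hκ0 : κ₀ ≠ 0 := by
        intro h0
        rw [h0, mul_zero, zero_pow two_ne_zero, ← hsR] at hκsq
        exact hs hκsq.symm
      -- the two candidates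
      set Mσ : ℂ → Module.End ℂ (archGardingSpace hcpt τ) :=
        fun σ => (1 + gardingAct hτ δ) * (1 + (1 / (2 * (σ * κ₀))) • (Lo : Module.End ℂ (archGardingSpace hcpt τ))) with hMσ
      have hMmem : ∀ σ, Mσ σ ∈ Algebra.adjoin ℂ (realPlaceGens hτ w δ) := fun σ =>
        Subalgebra.mul_mem _ (Subalgebra.add_mem _ (Subalgebra.one_mem _) hδm)
          (Subalgebra.add_mem _ (Subalgebra.one_mem _) (Subalgebra.smul_mem _ hLo _))
      have hMapply : ∀ σ, Mσ σ y = (y + (1 / (2 * (σ * κ₀))) • Lo y) + (1 : ℂ) • gardingAct hτ δ (y + (1 / (2 * (σ * κ₀))) • Lo y) := by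
        intro σ
        simp only [hMσ, Module.End.mul_apply, LinearMap.add_apply, Module.End.one_apply, LinearMap.smul_apply, one_smul]
      have hMapply' : ∀ σ, Mσ σ y = y + (1 / (2 * (σ * κ₀))) • Lo y + gardingAct hτ δ y + (1 / (2 * (σ * κ₀))) • gardingAct hτ δ (Lo y) := by
        intro σ
        rw [hMapply, one_smul, map_add, map_smul]
        abel
      have hfinal : ∀ σ, σ = 1 ∨ σ = -1 → RealFinal hτ w δ μ lam (Mσ σ y) := fun σ hσ => by
        have hσ2 : σ ^ 2 = 1 := by rcases hσ with h | h <;> rw [h] <;> norm_num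
        refine Or.inr (Or.inl ⟨σ * κ₀, ⟨Or.inl rfl, ?_, mul_ne_zero (by rcases hσ with h | h <;> rw [h] <;> norm_num) hκ0, y, hW1, hμ y, hlam y, ?_⟩⟩)
        · rw [← hκsq]; ring_nf; rw [hσ2, one_mul]
        · rw [hMapply]
      -- at least one candidate is non-zero: their sum is `2 (1 + τ(δ)) y ≠ 0`
      have hsum : Mσ 1 y + Mσ (-1) y = (2 : ℂ) • (y + gardingAct hτ δ y) := by
        set Ly : archGardingSpace hcpt τ := Lo y with hLy
        set dy : archGardingSpace hcpt τ := gardingAct hτ δ y with hdy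
        set dLy : archGardingSpace hcpt τ := gardingAct hτ δ (Lo y) with hdLy
        rw [hMapply', hMapply']
        have hc : 1 / (2 * ((-1 : ℂ) * κ₀)) = -(1 / (2 * ((1 : ℂ) * κ₀))) := by field_simp
        rw [hc]
        module
      rcases ne_or_eq (Mσ 1 y) 0 with h1 | h1
      · exact ⟨Mσ 1, hMmem 1, hKf (hMmem 1), h1, hfinal 1 (Or.inl rfl)⟩
      rcases ne_or_eq (Mσ (-1) y) 0 with h2 | h2
      · exact ⟨Mσ (-1), hMmem (-1), hKf (hMmem (-1)), h2, hfinal (-1) (Or.inr rfl)⟩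
      exfalso
      rw [h1, h2, zero_add, eq_comm, smul_eq_zero] at hsum
      exact add_gardingAct_realSign_ne_zero_of_weightOne hδ hy0 hW1 (hsum.resolve_left two_ne_zero)

end RealPlace

/-! ### 4. Complex places: raw data, final data, the Weyl datum, the modification step -/

section ComplexPlace

variable {hcpt : isCompact_glFiniteIntegralLevel 2 K}
  {E : Type*} [NormedAddCommGroup E] [InnerProductSpace ℂ E] [CompleteSpace E]
  {τ : ContRepresentation ℂ (AutomorphyDatum.gl 2 K hcpt).arch.carrier E}
  (hτ : τ.IsStronglyContinuous) (w : {w : InfinitePlace K // IsComplex w})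

local notation "𝐜" => ((0, Pi.single w 1) : mixedSpace K)
local notation "𝐜I" => ((0, Pi.single w Complex.I) : mixedSpace K)
local notation "Hc" => Matrix.single (0 : Fin 2) (0 : Fin 2) ((0, Pi.single w 1) : mixedSpace K)
local notation "D" => gardingEnd (hcpt := hcpt) (τ := τ) hτ
local notation "A[" y "]" => gardingAct (hcpt := hcpt) (τ := τ) hτ (expGL ((y : ℝ) • Hc))
local notation "Dh[" i "," j "]" => (gardingEnd (hcpt := hcpt) (τ := τ) hτ (Matrix.single (i : Fin 2) (j : Fin 2) ((0, Pi.single w 1) : mixedSpace K)) -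
  Complex.I • gardingEnd (hcpt := hcpt) (τ := τ) hτ (Matrix.single (i : Fin 2) (j : Fin 2) ((0, Pi.single w Complex.I) : mixedSpace K)))
local notation "Da[" i "," j "]" => (gardingEnd (hcpt := hcpt) (τ := τ) hτ (Matrix.single (i : Fin 2) (j : Fin 2) ((0, Pi.single w 1) : mixedSpace K)) +
  Complex.I • gardingEnd (hcpt := hcpt) (τ := τ) hτ (Matrix.single (i : Fin 2) (j : Fin 2) ((0, Pi.single w Complex.I) : mixedSpace K)))
local notation "Tc" => (Matrix.single (0 : Fin 2) (0 : Fin 2) ((0, Pi.single w Complex.I) : mixedSpace K) -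
  Matrix.single (1 : Fin 2) (1 : Fin 2) ((0, Pi.single w Complex.I) : mixedSpace K))
local notation "Zc" => (Matrix.single (0 : Fin 2) (0 : Fin 2) ((0, Pi.single w Complex.I) : mixedSpace K) +
  Matrix.single (1 : Fin 2) (1 : Fin 2) ((0, Pi.single w Complex.I) : mixedSpace K))
local notation "Jc" => (Matrix.single (0 : Fin 2) (1 : Fin 2) ((0, Pi.single w 1) : mixedSpace K) -
  Matrix.single (1 : Fin 2) (0 : Fin 2) ((0, Pi.single w 1) : mixedSpace K))
local notation "Rc" => gardingAct (hcpt := hcpt) (τ := τ) hτ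
  (expGL ((Real.pi / 2 : ℝ) • (Matrix.single (0 : Fin 2) (1 : Fin 2) ((0, Pi.single w 1) : mixedSpace K) -
    Matrix.single (1 : Fin 2) (0 : Fin 2) ((0, Pi.single w 1) : mixedSpace K))))

/-- **Raw data of the base vector at a complex place**: highest of torus weight `im` and, for `m ≥ 2`, killed by
the descent operator. [cite: JacquetLanglands1970, §6 Thm. 6.2] -/
structure ComplexRaw (v : archGardingSpace hcpt τ) (m : ℕ) : Prop where
  raising : (Dh[0,1] - Da[1,0]) v = 0
  torus : D Tc v = (Complex.I * m) • v
  descent : 2 ≤ m → descentOp hτ w m v = 0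

/-- **Final data at a complex place** with given torus character `μ₂`: one of the three shape types whose
torus weight `it` satisfies `it + μ₂ = 0`. [cite: JacquetLanglands1970, §6 Thm. 6.4] -/
def ComplexFinal (m : ℕ) (μ₂ : ℂ) (v : archGardingSpace hcpt τ) : Prop :=
  (∃ b : ℕ, ComplexHolPow hτ w v b m ∧ Complex.I * ((m : ℂ) + 2 * b) + μ₂ = 0) ∨
    (∃ b : ℕ, ComplexAntiPowLowest hτ w v b m ∧ Complex.I * (-(m : ℂ) - 2 * b) + μ₂ = 0) ∨
    (∃ j : ℕ, 0 < j ∧ j < m ∧ ComplexString hτ w v j m ∧ Complex.I * ((m : ℂ) - 2 * j) + μ₂ = 0)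

/-- The generators of the place: the eight letters. [folklore] -/
def complexPlaceGens : Set (Module.End ℂ (archGardingSpace hcpt τ)) :=
  Set.range (fun p : Fin 2 × Fin 2 => D (Matrix.single p.1 p.2 𝐜)) ∪ Set.range (fun p : Fin 2 × Fin 2 => D (Matrix.single p.1 p.2 𝐜I))

variable {hτ w}

/-- Unfolding the commutation with the generators. [folklore] -/
theorem commute_complexPlaceGens_iff {Φ : Module.End ℂ (archGardingSpace hcpt τ)} :
    (∀ T ∈ complexPlaceGens hτ w, Commute Φ T) ↔
      (∀ i j : Fin 2, Commute Φ (D (Matrix.single i j 𝐜))) ∧ ∀ i j : Fin 2, Commute Φ (D (Matrix.single i j 𝐜I)) := by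
  constructor
  · intro h
    exact ⟨fun i j => h _ (Or.inl ⟨(i, j), rfl⟩), fun i j => h _ (Or.inr ⟨(i, j), rfl⟩)⟩
  · rintro ⟨h1, h2⟩ T (⟨p, rfl⟩ | ⟨p, rfl⟩)
    · exact h1 p.1 p.2
    · exact h2 p.1 p.2

/-- The generated subalgebra preserves `archKFinite`. [folklore] -/
theorem complexPlaceGens_mem_archKFinite : ∀ T ∈ complexPlaceGens hτ w, ∀ u ∈ archKFinite hτ, T u ∈ archKFinite hτ := by
  rintro T (⟨p, rfl⟩ | ⟨p, rfl⟩) u hu <;> exact gardingEnd_mem_archKFinite hτ _ hu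

/-- The letters, `τ^h(E_{ij})`, `τ^a(E_{ij})`, `E_w`, `F_w` lie in the generated subalgebra. [folklore] -/
theorem mem_adjoin_complexPlaceGens :
    (∀ i j : Fin 2, (Dh[i,j] : Module.End ℂ (archGardingSpace hcpt τ)) ∈ Algebra.adjoin ℂ (complexPlaceGens hτ w)) ∧
    (∀ i j : Fin 2, (Da[i,j] : Module.End ℂ (archGardingSpace hcpt τ)) ∈ Algebra.adjoin ℂ (complexPlaceGens hτ w)) ∧
    ((Dh[0,1] - Da[1,0] : Module.End ℂ (archGardingSpace hcpt τ)) ∈ Algebra.adjoin ℂ (complexPlaceGens hτ w)) ∧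
    ((Dh[1,0] - Da[0,1] : Module.End ℂ (archGardingSpace hcpt τ)) ∈ Algebra.adjoin ℂ (complexPlaceGens hτ w)) := by
  have h1 : ∀ i j : Fin 2, D (Matrix.single i j 𝐜) ∈ Algebra.adjoin ℂ (complexPlaceGens hτ w) :=
    fun i j => Algebra.subset_adjoin (Or.inl ⟨(i, j), rfl⟩)
  have h2 : ∀ i j : Fin 2, D (Matrix.single i j 𝐜I) ∈ Algebra.adjoin ℂ (complexPlaceGens hτ w) :=
    fun i j => Algebra.subset_adjoin (Or.inr ⟨(i, j), rfl⟩)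
  have hh : ∀ i j : Fin 2, (Dh[i,j] : Module.End ℂ (archGardingSpace hcpt τ)) ∈ Algebra.adjoin ℂ (complexPlaceGens hτ w) :=
    fun i j => Subalgebra.sub_mem _ (h1 i j) (Subalgebra.smul_mem _ (h2 i j) _)
  have ha : ∀ i j : Fin 2, (Da[i,j] : Module.End ℂ (archGardingSpace hcpt τ)) ∈ Algebra.adjoin ℂ (complexPlaceGens hτ w) :=
    fun i j => Subalgebra.add_mem _ (h1 i j) (Subalgebra.smul_mem _ (h2 i j) _)
  exact ⟨hh, ha, Subalgebra.sub_mem _ (hh 0 1) (ha 1 0), Subalgebra.sub_mem _ (hh 1 0) (ha 0 1)⟩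

/-- Transport of the raw data. [folklore] -/
theorem ComplexRaw.map {Φ : Module.End ℂ (archGardingSpace hcpt τ)}
    (h1 : ∀ i j : Fin 2, Commute Φ (D (Matrix.single i j 𝐜))) (h2 : ∀ i j : Fin 2, Commute Φ (D (Matrix.single i j 𝐜I)))
    {v : archGardingSpace hcpt τ} {m : ℕ} (h : ComplexRaw hτ w v m) : ComplexRaw hτ w (Φ v) m := by
  obtain ⟨hT, hE, -⟩ := commute_torusC_raisingK_loweringK hτ w h1 h2
  refine ⟨?_, ?_, fun hm => ?_⟩
  · rw [← Module.End.mul_apply, ← hE.eq, Module.End.mul_apply, h.raising, map_zero]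
  · rw [← Module.End.mul_apply, ← hT.eq, Module.End.mul_apply, h.torus, map_smul]
  · rw [← Module.End.mul_apply, ← (commute_descentOp hτ w h1 h2 _).eq, Module.End.mul_apply, h.descent hm, map_zero]

/-- Transport of the final data. [folklore] -/
theorem ComplexFinal.map {Φ : Module.End ℂ (archGardingSpace hcpt τ)}
    (h1 : ∀ i j : Fin 2, Commute Φ (D (Matrix.single i j 𝐜))) (h2 : ∀ i j : Fin 2, Commute Φ (D (Matrix.single i j 𝐜I)))
    (hR : Commute Φ (Rc)) {m : ℕ} {μ₂ : ℂ} {v : archGardingSpace hcpt τ} (h : ComplexFinal hτ w m μ₂ v) :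
    ComplexFinal hτ w m μ₂ (Φ v) := by
  rcases h with ⟨b, h, hb⟩ | ⟨b, h, hb⟩ | ⟨j, hj, hjm, h, hb⟩
  · exact Or.inl ⟨b, h.map w h1 h2 hR, hb⟩
  · exact Or.inr (Or.inl ⟨b, h.map w h1 h2 hR, hb⟩)
  · exact Or.inr (Or.inr ⟨j, hj, hjm, h.map w h1 h2 hR, hb⟩)

/-! #### Matrices of the place -/

omit [NumberField K] in
/-- Products of the idempotent letters: `(E_{ij} ⊗ a)(E_{kl} ⊗ b) = δ_{jk} E_{il} ⊗ ab` with `c c = c`, `c ic = ic`,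
`ic ic = -c`. [folklore] -/
theorem complexPlace_matrix_facts :
    Jc * Jc = -(Matrix.single (0 : Fin 2) (0 : Fin 2) 𝐜 + Matrix.single 1 1 𝐜) ∧
    (Matrix.single (0 : Fin 2) (0 : Fin 2) 𝐜 + Matrix.single 1 1 𝐜) * Jc = Jc ∧
    Jc * Tc = -(Matrix.single (0 : Fin 2) (1 : Fin 2) 𝐜I + Matrix.single 1 0 𝐜I) ∧
    Tc * Jc = Matrix.single (0 : Fin 2) (1 : Fin 2) 𝐜I + Matrix.single 1 0 𝐜I ∧
    (Matrix.single (0 : Fin 2) (0 : Fin 2) 𝐜 + Matrix.single 1 1 𝐜) * Tc = Tc ∧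
    Tc * (Matrix.single (0 : Fin 2) (0 : Fin 2) 𝐜 + Matrix.single 1 1 𝐜) = Tc := by
  have hcc : 𝐜 * 𝐜 = 𝐜 := complexIdem_mul_self (K := K) w
  have hci : 𝐜 * 𝐜I = 𝐜I := complexIdem_mul_complexIdemI (K := K) w
  have hic : 𝐜I * 𝐜 = 𝐜I := complexIdemI_mul_complexIdem (K := K) w
  refine ⟨?_, ?_, ?_, ?_, ?_, ?_⟩ <;>
    simp only [mul_sub, sub_mul, mul_add, add_mul, single_mul_single_eq, hcc, hci, hic] <;>
    simp <;> abel

open scoped Matrix.Norms.Operator in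
/-- The matrix of the Weyl rotation: `exp((π/2) J_w) = 1 - P_w + J_w`. [folklore] -/
theorem coe_weylRotC :
    ((expGL ((Real.pi / 2 : ℝ) • Jc) : GL (Fin 2) (mixedSpace K)) : Matrix (Fin 2) (Fin 2) (mixedSpace K)) =
      1 - (Matrix.single (0 : Fin 2) (0 : Fin 2) 𝐜 + Matrix.single 1 1 𝐜) + Jc := by
  obtain ⟨hJ, hP, -⟩ := complexPlace_matrix_facts (K := K) (w := w)
  rw [coe_expGL, exp_smul_eq_of_sq_eq_neg hJ hP, Real.cos_pi_div_two, Real.sin_pi_div_two, zero_sub, neg_one_smul, one_smul]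
  abel

/-- The Weyl rotation anticommutes with the torus generator: `R T = -T R`. [folklore] -/
theorem weylRotC_mul_torusC :
    ((expGL ((Real.pi / 2 : ℝ) • Jc) : GL (Fin 2) (mixedSpace K)) : Matrix (Fin 2) (Fin 2) (mixedSpace K)) * Tc =
      -(Tc * ((expGL ((Real.pi / 2 : ℝ) • Jc) : GL (Fin 2) (mixedSpace K)) : Matrix (Fin 2) (Fin 2) (mixedSpace K))) := by
  obtain ⟨-, -, hJT, hTJ, hPT, hTP⟩ := complexPlace_matrix_facts (K := K) (w := w)
  rw [coe_weylRotC, add_mul, sub_mul, one_mul, hPT, hJT, mul_add, mul_sub, mul_one, hTP, hTJ]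
  abel

/-- `τ(T_w) τ(R) v = -τ(R) τ(T_w) v`. [folklore] -/
theorem torusC_weylRotC_apply (v : archGardingSpace hcpt τ) : D Tc (Rc v) = -(Rc (D Tc v)) := by
  have hconj : ((expGL ((Real.pi / 2 : ℝ) • Jc) : GL (Fin 2) (mixedSpace K)) : Matrix (Fin 2) (Fin 2) (mixedSpace K)) * (-Tc) *
      (((expGL ((Real.pi / 2 : ℝ) • Jc))⁻¹ : GL (Fin 2) (mixedSpace K)) : Matrix (Fin 2) (Fin 2) (mixedSpace K)) = Tc := by
    rw [Matrix.mul_neg, weylRotC_mul_torusC, neg_neg, Matrix.mul_assoc, ← Units.val_mul, mul_inv_cancel, Units.val_one, Matrix.mul_one]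
  have h := gardingAct_mul_gardingEnd (hcpt := hcpt) (τ := τ) hτ (expGL ((Real.pi / 2 : ℝ) • Jc)) (-Tc)
  rw [hconj, gardingEnd_neg] at h
  have h' := congrArg (fun T => T v) h
  simp only [Module.End.mul_apply, LinearMap.neg_apply, map_neg] at h'
  rw [← h']

/-- The compact torus at angle `2π` is trivial: `exp(2π E₀₀ ⊗ ic_w) = 1`. [folklore] -/
theorem expGL_two_pi_cornerI : (expGL ((2 * Real.pi : ℝ) • Matrix.single (0 : Fin 2) (0 : Fin 2) 𝐜I) : GL (Fin 2) (mixedSpace K)) = 1 := by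
  refine Units.ext ?_
  rw [coe_expGL_smul_single_complexIdemI, Units.val_one]
  have h : Complex.exp ((2 * Real.pi : ℝ) * Complex.I) = 1 := by
    rw [Complex.exp_eq_one_iff]; exact ⟨1, by push_cast; ring⟩
  rw [h, sub_self, Pi.single_zero, ← Prod.zero_eq_mk, Matrix.single_zero, add_zero]

/-! #### The Weyl datum of a `K_∞`-finite highest vector -/

/-- **The Weyl rotation maps a non-zero `K_∞`-finite highest vector of torus weight `im` to a non-zero multiple of
the lowest vector `F^m y` of its string** (the string spans an `E, F, T`-stable, hence `exp((π/2)τ(J))`-stable,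
finite-dimensional space with one-dimensional torus weight spaces, and `Ad(R) T = -T`).
[cite: JacquetLanglands1970, §6 Thm. 6.2] [cite: Knapp1986, Ch. VIII §3] -/
theorem exists_weylDatum {y : archGardingSpace hcpt τ} (hy : y ∈ archKFinite hτ) (hy0 : y ≠ 0) {m : ℕ}
    (hE : (Dh[0,1] - Da[1,0]) y = 0) (hT : D Tc y = (Complex.I * m) • y) :
    ((Dh[1,0] - Da[0,1]) ^ (m + 1)) y = 0 ∧ (∀ j ≤ m, ((Dh[1,0] - Da[0,1]) ^ j) y ≠ 0) ∧
      ∃ c : ℂ, c ≠ 0 ∧ Rc y = c • ((Dh[1,0] - Da[0,1]) ^ m) y := by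
  -- the string
  obtain ⟨V, hVfd, hK, hyV⟩ := (mem_archKFinite_iff hτ).mp hy
  haveI := hVfd
  obtain ⟨m', hm', hF1, hF2⟩ := exists_nat_weight_of_highest hτ w hK hyV hy0 hE hT
  have hmm : m' = m := by
    have h := mul_left_cancel₀ Complex.I_ne_zero hm'
    exact_mod_cast h.symm
  subst hmm
  refine ⟨hF1, hF2, ?_⟩
  set F : Module.End ℂ (archGardingSpace hcpt τ) := Dh[1,0] - Da[0,1] with hFdef
  set Er : Module.End ℂ (archGardingSpace hcpt τ) := Dh[0,1] - Da[1,0] with hEdef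
  set b : Fin (m' + 1) → archGardingSpace hcpt τ := fun j => (F ^ (j : ℕ)) y with hb
  set V₀ : Submodule ℂ (archGardingSpace hcpt τ) := Submodule.span ℂ (Set.range b) with hV₀
  haveI : FiniteDimensional ℂ V₀ := FiniteDimensional.span_of_finite ℂ (Set.finite_range b)
  have hbmem : ∀ j : Fin (m' + 1), b j ∈ V₀ := fun j => Submodule.subset_span ⟨j, rfl⟩
  -- stability under `F`, `E`
  have hFmem : ∀ j : Fin (m' + 1), F (b j) ∈ V₀ := by
    intro j
    by_cases hj : (j : ℕ) + 1 ≤ m'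
    · have e : F (b j) = b ⟨(j : ℕ) + 1, by omega⟩ := by
        simp only [hb, ← Module.End.mul_apply, ← pow_succ']
      rw [e]; exact hbmem _
    · have hj' : (j : ℕ) = m' := by omega
      have e : F (b j) = (F ^ (m' + 1)) y := by
        simp only [hb, ← Module.End.mul_apply, ← pow_succ', hj']
      rw [e, hF1]; exact Submodule.zero_mem _
  have hEmem : ∀ j : Fin (m' + 1), Er (b j) ∈ V₀ := by
    intro j
    rcases Nat.eq_zero_or_pos (j : ℕ) with hj | hj
    · have e : Er (b j) = 0 := by simp only [hb, hj, pow_zero, Module.End.one_apply]; exact hE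
      rw [e]; exact Submodule.zero_mem _
    · obtain ⟨i, hi⟩ : ∃ i : ℕ, (j : ℕ) = i + 1 := ⟨(j : ℕ) - 1, by omega⟩
      have e : Er (b j) = (4 * ((i : ℂ) + 1) * ((m' : ℂ) - i)) • b ⟨i, by omega⟩ := by
        simp only [hb, hi]
        exact raisingK_loweringK_pow_succ_apply hτ w m' y hE hT i
      rw [e]; exact Submodule.smul_mem _ _ (hbmem _)
  -- stability under `τ(J) = (E - F)/2`
  have hJ : D Jc = (2 : ℂ)⁻¹ • (Er - F) := by
    obtain ⟨h1, h2⟩ := raisingK_loweringK_eq (hcpt := hcpt) (τ := τ) hτ w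
    rw [hEdef, hFdef, h1, h2]
    module
  have hJmem : ∀ v ∈ V₀, D Jc v ∈ V₀ := by
    have hle : V₀.map (D Jc) ≤ V₀ := by
      rw [hV₀, Submodule.map_span_le]
      rintro _ ⟨j, rfl⟩
      rw [hJ, LinearMap.smul_apply, LinearMap.sub_apply]
      exact Submodule.smul_mem _ _ (Submodule.sub_mem _ (hEmem j) (hFmem j))
    exact fun v hv => hle (Submodule.mem_map_of_mem hv)
  have hRmem : Rc y ∈ V₀ := gardingAct_expGL_mem_of_gardingEnd_mem hτ hJmem _ (hbmem ⟨0, by omega⟩)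
  -- coordinates and the torus weight
  obtain ⟨c, hc⟩ := (Submodule.mem_span_range_iff_exists_fun ℂ).mp hRmem
  have hTb : ∀ j : Fin (m' + 1), D Tc (b j) = (Complex.I * ((m' : ℂ) - 2 * (j : ℕ))) • b j := fun j =>
    torusC_loweringK_pow_apply hτ w m' y hT j
  have hTR : D Tc (Rc y) = (Complex.I * ((m' : ℂ) - 2 * m')) • Rc y := by
    rw [torusC_weylRotC_apply, hT, map_smul, ← neg_smul]
    congr 1; ring
  have hlin : LinearIndependent ℂ b := by
    refine Module.End.eigenvectors_linearIndependent' (D Tc) (fun j : Fin (m' + 1) => Complex.I * ((m' : ℂ) - 2 * (j : ℕ)))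
      (fun i j hij => ?_) b fun j => ?_
    · have h := mul_left_cancel₀ Complex.I_ne_zero hij
      have h2 : ((i : ℕ) : ℂ) = ((j : ℕ) : ℂ) := by linear_combination -h / 2
      exact Fin.ext (by exact_mod_cast h2)
    · exact Module.End.hasEigenvector_iff.mpr ⟨Module.End.mem_eigenspace_iff.mpr (hTb j), hF2 j (by omega)⟩
  have hcoef : ∀ j : Fin (m' + 1), c j * (Complex.I * ((m' : ℂ) - 2 * (j : ℕ)) - Complex.I * ((m' : ℂ) - 2 * m')) = 0 := by
    have hsum : ∑ j, (c j * (Complex.I * ((m' : ℂ) - 2 * (j : ℕ)) - Complex.I * ((m' : ℂ) - 2 * m'))) • b j = 0 := by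
      have h1 : D Tc (∑ j, c j • b j) = ∑ j, (c j * (Complex.I * ((m' : ℂ) - 2 * (j : ℕ)))) • b j := by
        rw [_root_.map_sum]
        refine Finset.sum_congr rfl fun j _ => ?_
        rw [map_smul, hTb, smul_smul]
      have h2 : D Tc (∑ j, c j • b j) = ∑ j, (c j * (Complex.I * ((m' : ℂ) - 2 * m'))) • b j := by
        rw [hc, hTR, ← hc, Finset.smul_sum]
        refine Finset.sum_congr rfl fun j _ => ?_
        rw [smul_smul, mul_comm]
      have h3 := sub_eq_zero.mpr (h1.symm.trans h2)
      rw [← Finset.sum_sub_distrib] at h3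
      simpa only [← sub_smul, ← mul_sub] using h3
    exact Fintype.linearIndependent_iff.mp hlin _ hsum
  have hcj : ∀ j : Fin (m' + 1), (j : ℕ) ≠ m' → c j = 0 := by
    intro j hj
    have h := hcoef j
    have hne : Complex.I * ((m' : ℂ) - 2 * (j : ℕ)) - Complex.I * ((m' : ℂ) - 2 * m') ≠ 0 := by
      rw [← mul_sub, sub_sub_sub_cancel_left]
      refine mul_ne_zero Complex.I_ne_zero (sub_ne_zero.mpr ?_)
      intro h2
      have : ((m' : ℕ) : ℂ) = ((j : ℕ) : ℂ) := by linear_combination h2 / 2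
      exact hj (by exact_mod_cast this.symm)
    exact (mul_eq_zero.mp h).resolve_right hne
  -- conclusion
  set jm : Fin (m' + 1) := ⟨m', by omega⟩ with hjm
  have hRy : Rc y = c jm • (F ^ m') y := by
    rw [← hc, ← Finset.sum_subset (Finset.subset_univ {jm}), Finset.sum_singleton]
    intro j _ hj
    rw [hcj j (fun h => hj (Finset.mem_singleton.mpr (Fin.ext h))), zero_smul]
  refine ⟨c jm, fun h0 => hy0 ?_, hRy⟩
  rw [h0, zero_smul] at hRy
  have h1 : gardingAct hτ (expGL ((Real.pi / 2 : ℝ) • Jc))⁻¹ (Rc y) = y := by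
    rw [← Module.End.mul_apply, ← gardingAct_mul, inv_mul_cancel, gardingAct_one, Module.End.one_apply]
  rw [← h1, hRy, map_zero]

/-! #### Integrality of the torus character -/

/-- **The torus character is integral**: if a non-zero vector has torus weight `im` and `τ(Z^I_w)`-scalar `μ₂`, then
`μ₂ = -i(m - 2n)` for an integer `n` (`exp(2π E₀₀ ⊗ ic) = 1`). [cite: JacquetLanglands1970, §6] -/
theorem exists_int_torusChar {y : archGardingSpace hcpt τ} (hy0 : y ≠ 0) {t μ₂ : ℂ} (hT : D Tc y = (Complex.I * t) • y)
    (hZ2 : D Zc y = μ₂ • y) : ∃ n : ℤ, μ₂ = -Complex.I * (t - 2 * n) := by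
  have h := gardingAct_expGL_cornerI_eq_exp_smul w hT hZ2 (2 * Real.pi)
  rw [expGL_two_pi_cornerI, gardingAct_one, Module.End.one_apply, eq_comm] at h
  have h1 : Complex.exp ((Complex.I * t + μ₂) / 2 * ((2 * Real.pi : ℝ) : ℂ)) = 1 := by
    by_contra hne
    have h2 : (Complex.exp ((Complex.I * t + μ₂) / 2 * ((2 * Real.pi : ℝ) : ℂ)) - 1) • y = 0 := by rw [sub_smul, one_smul, h, sub_self]
    exact hy0 ((smul_eq_zero.mp h2).resolve_left (sub_ne_zero.mpr hne))
  obtain ⟨n, hn⟩ := Complex.exp_eq_one_iff.mp h1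
  refine ⟨n, ?_⟩
  have hπ : (Real.pi : ℂ) ≠ 0 := by exact_mod_cast Real.pi_pos.ne'
  have h3 : (Complex.I * t + μ₂) * Real.pi = n * (2 * Real.pi * Complex.I) := by rw [← hn]; push_cast; ring
  have h4 : Complex.I * t + μ₂ = 2 * n * Complex.I := by
    have := mul_right_cancel₀ hπ (h3.trans (by ring : (n : ℂ) * (2 * Real.pi * Complex.I) = 2 * n * Complex.I * Real.pi))
    exact this
  linear_combination h4

/-! #### Non-vanishing of the modifications -/

variable (hτu : τ.IsUnitary) (hτi : τ.IsTopIrreducible) {ℓ : archGardingSpace hcpt τ →ₗ[ℂ] ℂ}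
  (hℓW : IsArchContWhittakerFunctional hcpt τ hτ ℓ) (hne : ℓ ≠ 0)
include hτu hτi hℓW hne

/-- `τ^h(E₀₁)^b y ≠ 0` and `τ^a(E₀₁)^b y ≠ 0` for a non-zero `K_∞`-finite `y`. [folklore] -/
theorem hol01_pow_ne_zero {y : archGardingSpace hcpt τ} (hy : y ∈ archKFinite hτ) (hy0 : y ≠ 0) (b : ℕ) :
    (Dh[0,1] ^ b) y ≠ 0 ∧ (Da[0,1] ^ b) y ≠ 0 := by
  have hyS := not_mem_kirillovNull_of_mem_archKFinite hτ hτu hτi hℓW hne hy hy0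
  constructor
  · intro h0
    exact hyS (mem_kirillovNull_of_pow_mem hτ (T := Dh[0,1]) (fun v hv => mem_kirillovNull_of_hol01_mem hτ hℓW w hv) b
      (by rw [h0]; exact Submodule.zero_mem _))
  · intro h0
    exact hyS (mem_kirillovNull_of_pow_mem hτ (T := Da[0,1]) (fun v hv => mem_kirillovNull_of_anti01_mem hτ hℓW w hv) b
      (by rw [h0]; exact Submodule.zero_mem _))

/-- **The modification step at a complex place**: from a non-zero `K_∞`-finite vector with raw data and the torus
character `μ₂` of `τ`, an operator `M` in the subalgebra of the place with `M y` non-zero, `K_∞`-finite and of a final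
type (`τ^h(E₀₁)^b`, `τ^a(E₀₁)^b F^m` or `F^j` according to the position of the integer `-iμ₂` relative to the
string `[-m, m]`). [cite: JacquetLanglands1970, §6 Thm. 6.4] -/
theorem complexStep {μ₂ : ℂ} (hZ2 : ∀ v : archGardingSpace hcpt τ, D Zc v = μ₂ • v)
    {y : archGardingSpace hcpt τ} (hy : y ∈ archKFinite hτ) (hy0 : y ≠ 0) {m : ℕ} (hraw : ComplexRaw hτ w y m) :
    ∃ M : Module.End ℂ (archGardingSpace hcpt τ), M ∈ Algebra.adjoin ℂ (complexPlaceGens hτ w) ∧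
      M y ∈ archKFinite hτ ∧ M y ≠ 0 ∧ ComplexFinal hτ w m μ₂ (M y) ∧ (2 ≤ m ∨ ¬∃ j : ℕ, 0 < j ∧ j < m) := by
  obtain ⟨hh, ha, hEm, hFm⟩ := mem_adjoin_complexPlaceGens (hτ := hτ) (w := w)
  have hKf : ∀ {M : Module.End ℂ (archGardingSpace hcpt τ)}, M ∈ Algebra.adjoin ℂ (complexPlaceGens hτ w) → M y ∈ archKFinite hτ :=
    fun hM => mem_of_mem_adjoin complexPlaceGens_mem_archKFinite hM hy
  obtain ⟨hF1, hF2, c, hc, hRy⟩ := exists_weylDatum hy hy0 hraw.raising hraw.torus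
  have hinner : ComplexInner hτ w y m := ⟨hraw.raising, hraw.torus, hF1, c, hc, hRy⟩
  obtain ⟨n, hn⟩ := exists_int_torusChar hy0 hraw.torus (hZ2 y)
  have htriv : 2 ≤ m ∨ ¬∃ j : ℕ, 0 < j ∧ j < m := by
    by_cases hm : 2 ≤ m
    · exact Or.inl hm
    · exact Or.inr fun ⟨j, hj1, hj2⟩ => hm (by omega)
  rcases le_or_gt n 0 with hn0 | hn0
  · -- `t₀ = m - 2n ≥ m`: holomorphic powers
    set b : ℕ := (-n).toNat with hb
    have hbn : (b : ℤ) = -n := by rw [hb, Int.toNat_of_nonneg (by omega)]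
    refine ⟨Dh[0,1] ^ b, Subalgebra.pow_mem _ (hh 0 1) b, hKf (Subalgebra.pow_mem _ (hh 0 1) b), (hol01_pow_ne_zero hτu hτi hℓW hne hy hy0 b).1,
      Or.inl ⟨b, ⟨y, hinner, rfl⟩, ?_⟩, htriv⟩
    rw [hn]
    have : ((b : ℕ) : ℂ) = -(n : ℂ) := by exact_mod_cast hbn
    rw [this]; ring
  rcases le_or_gt (m : ℤ) n with hnm | hnm
  · -- `t₀ ≤ -m`: antiholomorphic powers of the lowest vector
    set b : ℕ := (n - m).toNat with hb
    have hbn : (b : ℤ) = n - m := by rw [hb, Int.toNat_of_nonneg (by omega)]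
    have hlow : (((Dh[1,0] - Da[0,1]) ^ m) y) ∈ archKFinite hτ := hKf (Subalgebra.pow_mem _ hFm m)
    refine ⟨Da[0,1] ^ b * (Dh[1,0] - Da[0,1]) ^ m, Subalgebra.mul_mem _ (Subalgebra.pow_mem _ (ha 0 1) b) (Subalgebra.pow_mem _ hFm m),
      hKf (Subalgebra.mul_mem _ (Subalgebra.pow_mem _ (ha 0 1) b) (Subalgebra.pow_mem _ hFm m)), ?_,
      Or.inr (Or.inl ⟨b, ⟨y, hinner, by rw [Module.End.mul_apply]⟩, ?_⟩), htriv⟩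
    · rw [Module.End.mul_apply]
      exact (hol01_pow_ne_zero hτu hτi hℓW hne hlow (hF2 m le_rfl) b).2
    · rw [hn]
      have : ((b : ℕ) : ℂ) = (n : ℂ) - m := by exact_mod_cast hbn
      rw [this]; ring
  · -- `-m < t₀ < m`: a member of the string
    set j : ℕ := n.toNat with hj
    have hjn : (j : ℤ) = n := by rw [hj, Int.toNat_of_nonneg (by omega)]
    have hj0 : 0 < j := by omega
    have hjm : j < m := by omega
    refine ⟨(Dh[1,0] - Da[0,1]) ^ j, Subalgebra.pow_mem _ hFm j, hKf (Subalgebra.pow_mem _ hFm j), hF2 j hjm.le,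
      Or.inr (Or.inr ⟨j, hj0, hjm, ⟨hjm.le, y, hinner, rfl⟩, ?_⟩), htriv⟩
    rw [hn]
    have : ((j : ℕ) : ℂ) = (n : ℂ) := by exact_mod_cast hjn
    rw [this]; ring

end ComplexPlace

/-! ### 5. Commutation between different places; the construction of `e₀` -/

section Commutation

variable {hcpt : isCompact_glFiniteIntegralLevel 2 K}
  {E : Type*} [NormedAddCommGroup E] [InnerProductSpace ℂ E] [CompleteSpace E]
  {τ : ContRepresentation ℂ (AutomorphyDatum.gl 2 K hcpt).arch.carrier E}
  (hτ : τ.IsStronglyContinuous)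

local notation "D" => gardingEnd (hcpt := hcpt) (τ := τ) hτ

omit [NumberField K] in
/-- Root matrices with orthogonal coefficients commute. [folklore] -/
theorem commute_single_of_mul_eq_zero {x y : mixedSpace K} (hxy : x * y = 0) (hyx : y * x = 0) (i j k l : Fin 2) :
    Commute (Matrix.single i j x) (Matrix.single k l y) := by
  change Matrix.single i j x * Matrix.single k l y = Matrix.single k l y * Matrix.single i j x
  rw [single_mul_single_eq_zero_of_mul_eq_zero hxy, single_mul_single_eq_zero_of_mul_eq_zero hyx]

omit [NumberField K] in
/-- `1_i · 1_j = 0` in a product of monoids with zero, `i ≠ j`. [folklore] -/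
theorem pi_single_mul_single_of_ne {ι : Type*} [DecidableEq ι] {M : ι → Type*} [∀ i, MulZeroClass (M i)] {i j : ι} (h : i ≠ j)
    (a : M i) (b : M j) : (Pi.single i a : ∀ k, M k) * Pi.single j b = 0 := by
  ext k
  rw [Pi.mul_apply, Pi.zero_apply]
  by_cases hk : k = i
  · subst hk
    rw [Pi.single_eq_of_ne h, mul_zero]
  · rw [Pi.single_eq_of_ne hk, zero_mul]

omit [NumberField K] in
/-- The idempotents of different places are orthogonal. [folklore] -/
theorem place_coeff_mul_eq_zero :
    (∀ (w : {w : InfinitePlace K // IsReal w}) (w' : {w : InfinitePlace K // IsComplex w}) (a : ℂ),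
      ((Pi.single w 1, 0) : mixedSpace K) * ((0, Pi.single w' a) : mixedSpace K) = 0 ∧
      ((0, Pi.single w' a) : mixedSpace K) * ((Pi.single w 1, 0) : mixedSpace K) = 0) ∧
    (∀ (w w' : {w : InfinitePlace K // IsComplex w}) (a b : ℂ), w ≠ w' →
      ((0, Pi.single w a) : mixedSpace K) * ((0, Pi.single w' b) : mixedSpace K) = 0) ∧
    (∀ (w w' : {w : InfinitePlace K // IsReal w}), w ≠ w' →
      ((Pi.single w 1, 0) : mixedSpace K) * ((Pi.single w' 1, 0) : mixedSpace K) = 0) := by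
  refine ⟨fun w w' a => ⟨?_, ?_⟩, fun w w' a b h => ?_, fun w w' h => ?_⟩
  · rw [Prod.mk_mul_mk, mul_zero, zero_mul]; rfl
  · rw [Prod.mk_mul_mk, mul_zero, zero_mul]; rfl
  · rw [Prod.mk_mul_mk, mul_zero, pi_single_mul_single_of_ne h]; rfl
  · rw [Prod.mk_mul_mk, mul_zero, pi_single_mul_single_of_ne h]; rfl

/-- `τ(exp X)` commutes with `τ(Y)` if `X` and `Y` commute. [folklore] -/
theorem commute_gardingAct_expGL_gardingEnd {X Y : Matrix (Fin 2) (Fin 2) (mixedSpace K)} (h : Commute X Y) :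
    Commute (gardingAct hτ (expGL X)) (D Y) := by
  change gardingAct hτ (expGL X) * D Y = D Y * gardingAct hτ (expGL X)
  rw [gardingAct_mul_gardingEnd]
  congr 2
  have h1 : ((expGL X : GL (Fin 2) (mixedSpace K)) : Matrix (Fin 2) (Fin 2) (mixedSpace K)) * Y =
      Y * ((expGL X : GL (Fin 2) (mixedSpace K)) : Matrix (Fin 2) (Fin 2) (mixedSpace K)) := by
    rw [coe_expGL]; exact (h.exp_left).eq
  rw [h1, Matrix.mul_assoc, ← Units.val_mul, mul_inv_cancel, Units.val_one, Matrix.mul_one]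

/-- `τ(g)` commutes with `τ(g')` if the matrices commute. [folklore] -/
theorem commute_gardingAct_of_coe {g g' : GL (Fin 2) (mixedSpace K)}
    (h : Commute (g : Matrix (Fin 2) (Fin 2) (mixedSpace K)) (g' : Matrix (Fin 2) (Fin 2) (mixedSpace K))) :
    Commute (gardingAct hτ g) (gardingAct hτ g') := by
  change gardingAct hτ g * gardingAct hτ g' = gardingAct hτ g' * gardingAct hτ g
  rw [← gardingAct_mul, ← gardingAct_mul]
  congr 1
  exact Units.ext h.eq

variable {δf : {w : InfinitePlace K // IsReal w} → GL (Fin 2) (mixedSpace K)}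
  (hδf : ∀ w, (δf w : Matrix (Fin 2) (Fin 2) (mixedSpace K)) =
    1 - (2 : ℝ) • Matrix.single (0 : Fin 2) (0 : Fin 2) ((Pi.single w 1, 0) : mixedSpace K))
include hδf

/-- **Different places commute**: every generator of a place commutes with every generator of another place and
with the Weyl rotations of the other complex places. [folklore] -/
theorem commute_placeGens :
    (∀ w w' : {w : InfinitePlace K // IsReal w}, w ≠ w' →
      ∀ T ∈ realPlaceGens hτ w (δf w), ∀ T' ∈ realPlaceGens hτ w' (δf w'), Commute T T') ∧
    (∀ (w : {w : InfinitePlace K // IsReal w}) (w' : {w : InfinitePlace K // IsComplex w}),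
      ∀ T ∈ realPlaceGens hτ w (δf w), ∀ T' ∈ complexPlaceGens hτ w', Commute T T') ∧
    (∀ w w' : {w : InfinitePlace K // IsComplex w}, w ≠ w' →
      ∀ T ∈ complexPlaceGens hτ w, ∀ T' ∈ complexPlaceGens hτ w', Commute T T') ∧
    (∀ (w : {w : InfinitePlace K // IsReal w}) (w' : {w : InfinitePlace K // IsComplex w}),
      ∀ T ∈ realPlaceGens hτ w (δf w), Commute T (gardingAct hτ (expGL ((Real.pi / 2 : ℝ) •
        (Matrix.single (0 : Fin 2) (1 : Fin 2) ((0, Pi.single w' 1) : mixedSpace K) - Matrix.single (1 : Fin 2) (0 : Fin 2) ((0, Pi.single w' 1) : mixedSpace K)))))) ∧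
    (∀ w w' : {w : InfinitePlace K // IsComplex w}, w ≠ w' →
      ∀ T ∈ complexPlaceGens hτ w, Commute T (gardingAct hτ (expGL ((Real.pi / 2 : ℝ) •
        (Matrix.single (0 : Fin 2) (1 : Fin 2) ((0, Pi.single w' 1) : mixedSpace K) - Matrix.single (1 : Fin 2) (0 : Fin 2) ((0, Pi.single w' 1) : mixedSpace K)))))) := by
  obtain ⟨hrc, hcc, hrr⟩ := place_coeff_mul_eq_zero (K := K)
  refine ⟨fun w w' hww => ?_, fun w w' => ?_, fun w w' hww => ?_, fun w w' => ?_, fun w w' hww => ?_⟩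
  · rintro T (⟨p, rfl⟩ | hT) T' (⟨q, rfl⟩ | hT')
    · exact commute_gardingEnd_single_realIdem_of_ne hτ hww _ _ _ _
    · rw [Set.mem_singleton_iff.mp hT']
      exact ((commute_gardingAct_realSign_letters hτ (hδf w')).1 w hww _ _).symm
    · rw [Set.mem_singleton_iff.mp hT]
      exact (commute_gardingAct_realSign_letters hτ (hδf w)).1 w' (Ne.symm hww) _ _
    · rw [Set.mem_singleton_iff.mp hT, Set.mem_singleton_iff.mp hT']
      exact commute_gardingAct_realSign (hτ := hτ) (hδf := hδf) w w'
  · rintro T (⟨p, rfl⟩ | hT) T' (⟨q, rfl⟩ | ⟨q, rfl⟩)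
    · exact commute_gardingEnd_single_realIdem_inr hτ w w' _ _ _ _ _
    · exact commute_gardingEnd_single_realIdem_inr hτ w w' _ _ _ _ _
    · rw [Set.mem_singleton_iff.mp hT]; exact (commute_gardingAct_realSign_letters hτ (hδf w)).2 w' _ _ _
    · rw [Set.mem_singleton_iff.mp hT]; exact (commute_gardingAct_realSign_letters hτ (hδf w)).2 w' _ _ _
  · rintro T (⟨p, rfl⟩ | ⟨p, rfl⟩) T' (⟨q, rfl⟩ | ⟨q, rfl⟩) <;> exact commute_gardingEnd_single_inr_of_ne hτ hww _ _ _ _ _ _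
  · have hJ : ∀ (i j : Fin 2), Commute (Matrix.single i j ((Pi.single w 1, 0) : mixedSpace K))
        ((Real.pi / 2 : ℝ) • (Matrix.single (0 : Fin 2) (1 : Fin 2) ((0, Pi.single w' 1) : mixedSpace K) -
          Matrix.single (1 : Fin 2) (0 : Fin 2) ((0, Pi.single w' 1) : mixedSpace K))) := fun i j =>
      ((commute_single_of_mul_eq_zero (hrc w w' 1).1 (hrc w w' 1).2 i j 0 1).sub_right
        (commute_single_of_mul_eq_zero (hrc w w' 1).1 (hrc w w' 1).2 i j 1 0)).smul_right _
    rintro T (⟨p, rfl⟩ | hT)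
    · exact (commute_gardingAct_expGL_gardingEnd hτ (hJ p.1 p.2).symm).symm
    · rw [Set.mem_singleton_iff.mp hT]
      refine commute_gardingAct_of_coe hτ ?_
      rw [hδf w, coe_expGL]
      exact ((Commute.one_left _).sub_left (((hJ 0 0).smul_left (2 : ℝ)).exp_right))
  · have hJ : ∀ (a : ℂ) (i j : Fin 2), Commute (Matrix.single i j ((0, Pi.single w a) : mixedSpace K))
        ((Real.pi / 2 : ℝ) • (Matrix.single (0 : Fin 2) (1 : Fin 2) ((0, Pi.single w' 1) : mixedSpace K) -
          Matrix.single (1 : Fin 2) (0 : Fin 2) ((0, Pi.single w' 1) : mixedSpace K))) := fun a i j =>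
      ((commute_single_of_mul_eq_zero (hcc w w' a 1 hww) (hcc w' w 1 a (Ne.symm hww)) i j 0 1).sub_right
        (commute_single_of_mul_eq_zero (hcc w w' a 1 hww) (hcc w' w 1 a (Ne.symm hww)) i j 1 0)).smul_right _
    rintro T (⟨p, rfl⟩ | ⟨p, rfl⟩)
    · exact (commute_gardingAct_expGL_gardingEnd hτ (hJ 1 p.1 p.2).symm).symm
    · exact (commute_gardingAct_expGL_gardingEnd hτ (hJ Complex.I p.1 p.2).symm).symm

end Commutation

section Construction

variable {hcpt : isCompact_glFiniteIntegralLevel 2 K}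
  {E : Type*} [NormedAddCommGroup E] [InnerProductSpace ℂ E] [CompleteSpace E]
  {τ : ContRepresentation ℂ (AutomorphyDatum.gl 2 K hcpt).arch.carrier E}
  (hτ : τ.IsStronglyContinuous)

local notation "D" => gardingEnd (hcpt := hcpt) (τ := τ) hτ

variable (hτu : τ.IsUnitary) (hτi : τ.IsTopIrreducible) {ℓ : archGardingSpace hcpt τ →ₗ[ℂ] ℂ}
  (hℓW : IsArchContWhittakerFunctional hcpt τ hτ ℓ) (hne : ℓ ≠ 0)
  {δf : {w : InfinitePlace K // IsReal w} → GL (Fin 2) (mixedSpace K)}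
  (hδf : ∀ w, (δf w : Matrix (Fin 2) (Fin 2) (mixedSpace K)) =
    1 - (2 : ℝ) • Matrix.single (0 : Fin 2) (0 : Fin 2) ((Pi.single w 1, 0) : mixedSpace K))
  {μR lamR : {w : InfinitePlace K // IsReal w} → ℂ}
  (hμR : ∀ w (v : archGardingSpace hcpt τ), gardingEnd hτ (Matrix.single 0 0 ((Pi.single w 1, 0) : mixedSpace K)) v +
    gardingEnd hτ (Matrix.single 1 1 ((Pi.single w 1, 0) : mixedSpace K)) v = μR w • v)
  (hlamR : ∀ w (v : archGardingSpace hcpt τ), ∑ i : Fin 2, ∑ j : Fin 2, gardingEnd hτ (Matrix.single i j ((Pi.single w 1, 0) : mixedSpace K))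
    (gardingEnd hτ (Matrix.single j i ((Pi.single w 1, 0) : mixedSpace K)) v) = lamR w • v)
  {μ₂ : {w : InfinitePlace K // IsComplex w} → ℂ}
  (hμ₂ : ∀ w (v : archGardingSpace hcpt τ), gardingEnd hτ (Matrix.single 0 0 ((0, Pi.single w Complex.I) : mixedSpace K) +
    Matrix.single 1 1 ((0, Pi.single w Complex.I) : mixedSpace K)) v = μ₂ w • v)

include hτu hτi hℓW hne hδf hμR hlamR hμ₂

/-- **The construction of the test vector** (induction over the places): from a non-zero `K_∞`-finite vector with
raw data at all places, a non-zero `K_∞`-finite vector with final data at all places.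
[cite: JacquetLanglands1970, §5 Thm. 5.15, §6 Thm. 6.4, proof of Thm. 11.1] -/
theorem exists_final_of_raw {x : archGardingSpace hcpt τ} (hx : x ∈ archKFinite hτ) (hx0 : x ≠ 0)
    {kx : {w : InfinitePlace K // IsReal w} → ℕ} {mx : {w : InfinitePlace K // IsComplex w} → ℕ}
    (hR : ∀ w, RealRaw hτ w (δf w) x (kx w) (2 * lamR w - μR w ^ 2 + 1)) (hC : ∀ w, ComplexRaw hτ w x (mx w)) :
    ∃ e : archGardingSpace hcpt τ, e ∈ archKFinite hτ ∧ e ≠ 0 ∧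
      (∀ w, RealFinal hτ w (δf w) (μR w) (lamR w) e) ∧ (∀ w, ComplexFinal hτ w (mx w) (μ₂ w) e) ∧
      ∀ w, 2 ≤ mx w ∨ ¬∃ j : ℕ, 0 < j ∧ j < mx w := by
  obtain ⟨hRR, hRC, hCC, hRrot, hCrot⟩ := commute_placeGens hτ hδf
  -- induction over a finite set of places
  have key : ∀ s : Finset ({w : InfinitePlace K // IsReal w} ⊕ {w : InfinitePlace K // IsComplex w}),
      ∃ y : archGardingSpace hcpt τ, y ∈ archKFinite hτ ∧ y ≠ 0 ∧
        (∀ w, Sum.inl w ∈ s → RealFinal hτ w (δf w) (μR w) (lamR w) y) ∧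
        (∀ w, Sum.inl w ∉ s → RealRaw hτ w (δf w) y (kx w) (2 * lamR w - μR w ^ 2 + 1)) ∧
        (∀ w, Sum.inr w ∈ s → ComplexFinal hτ w (mx w) (μ₂ w) y) ∧
        (∀ w, Sum.inr w ∉ s → ComplexRaw hτ w y (mx w)) ∧
        ∀ w, Sum.inr w ∈ s → (2 ≤ mx w ∨ ¬∃ j : ℕ, 0 < j ∧ j < mx w) := by
    intro s
    induction s using Finset.induction_on with
    | empty => exact ⟨x, hx, hx0, fun w h => absurd h (Finset.notMem_empty _), fun w _ => hR w,
        fun w h => absurd h (Finset.notMem_empty _), fun w _ => hC w, fun w h => absurd h (Finset.notMem_empty _)⟩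
    | @insert i s hi ih =>
      obtain ⟨y, hy, hy0, hRF, hRW, hCF, hCW, htriv⟩ := ih
      rcases i with w | w
      · -- a real place
        obtain ⟨M, hM, hMy, hMy0, hfin⟩ := realStep (hδf w) hτu hτi hℓW hne (hμR w) (hlamR w) rfl hy hy0 (hRW w hi)
        -- `M` commutes with the other places
        have hcommR : ∀ w', w' ≠ w → (∀ i j : Fin 2, Commute M (D (Matrix.single i j ((Pi.single w' 1, 0) : mixedSpace K)))) ∧
            Commute M (gardingAct hτ (δf w')) := fun w' hw' =>
          commute_realPlaceGens_iff.mp fun T hT => (commute_of_mem_adjoin (fun T' hT' => (hRR w' w hw' T hT T' hT')) hM).symm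
        have hcommC : ∀ w', (∀ i j : Fin 2, Commute M (D (Matrix.single i j ((0, Pi.single w' 1) : mixedSpace K)))) ∧
            (∀ i j : Fin 2, Commute M (D (Matrix.single i j ((0, Pi.single w' Complex.I) : mixedSpace K)))) := fun w' =>
          commute_complexPlaceGens_iff.mp fun T hT => (commute_of_mem_adjoin (fun T' hT' => (hRC w w' T' hT' T hT).symm) hM).symm
        have hcommRot : ∀ w', Commute M (gardingAct hτ (expGL ((Real.pi / 2 : ℝ) •
            (Matrix.single (0 : Fin 2) (1 : Fin 2) ((0, Pi.single w' 1) : mixedSpace K) - Matrix.single (1 : Fin 2) (0 : Fin 2) ((0, Pi.single w' 1) : mixedSpace K))))) :=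
          fun w' => (commute_of_mem_adjoin (fun T' hT' => (hRrot w w' T' hT').symm) hM).symm
        refine ⟨M y, hMy, hMy0, fun w' hw' => ?_, fun w' hw' => ?_, fun w' hw' => ?_, fun w' hw' => ?_, fun w' hw' => ?_⟩
        · rcases Finset.mem_insert.mp hw' with h | h
          · cases h; exact hfin
          · have hne' : w' ≠ w := fun e => hi (e ▸ h)
            exact (hRF w' h).map (hcommR w' hne').1 (hcommR w' hne').2
        · have hne' : w' ≠ w := fun e => hw' (Finset.mem_insert.mpr (Or.inl (by rw [e])))
          exact (hRW w' fun h => hw' (Finset.mem_insert_of_mem h)).map (hcommR w' hne').1 (hcommR w' hne').2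
        · have h : Sum.inr w' ∈ s := by simpa using hw'
          exact (hCF w' h).map (hcommC w').1 (hcommC w').2 (hcommRot w')
        · exact (hCW w' fun h => hw' (Finset.mem_insert_of_mem h)).map (hcommC w').1 (hcommC w').2
        · exact htriv w' (by simpa using hw')
      · -- a complex place
        obtain ⟨M, hM, hMy, hMy0, hfin, htw⟩ := complexStep hτu hτi hℓW hne (hμ₂ w) hy hy0 (hCW w hi)
        have hcommR : ∀ w', (∀ i j : Fin 2, Commute M (D (Matrix.single i j ((Pi.single w' 1, 0) : mixedSpace K)))) ∧
            Commute M (gardingAct hτ (δf w')) := fun w' =>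
          commute_realPlaceGens_iff.mp fun T hT => (commute_of_mem_adjoin (fun T' hT' => hRC w' w T hT T' hT') hM).symm
        have hcommC : ∀ w', w' ≠ w → (∀ i j : Fin 2, Commute M (D (Matrix.single i j ((0, Pi.single w' 1) : mixedSpace K)))) ∧
            (∀ i j : Fin 2, Commute M (D (Matrix.single i j ((0, Pi.single w' Complex.I) : mixedSpace K)))) := fun w' hw' =>
          commute_complexPlaceGens_iff.mp fun T hT => (commute_of_mem_adjoin (fun T' hT' => (hCC w' w hw' T hT T' hT')) hM).symm
        have hcommRot : ∀ w', w' ≠ w → Commute M (gardingAct hτ (expGL ((Real.pi / 2 : ℝ) •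
            (Matrix.single (0 : Fin 2) (1 : Fin 2) ((0, Pi.single w' 1) : mixedSpace K) - Matrix.single (1 : Fin 2) (0 : Fin 2) ((0, Pi.single w' 1) : mixedSpace K))))) :=
          fun w' hw' => (commute_of_mem_adjoin (fun T' hT' => (hCrot w w' (Ne.symm hw') T' hT').symm) hM).symm
        refine ⟨M y, hMy, hMy0, fun w' hw' => ?_, fun w' hw' => ?_, fun w' hw' => ?_, fun w' hw' => ?_, fun w' hw' => ?_⟩
        · have h : Sum.inl w' ∈ s := by simpa using hw'
          exact (hRF w' h).map (hcommR w').1 (hcommR w').2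
        · exact (hRW w' fun h => hw' (Finset.mem_insert_of_mem h)).map (hcommR w').1 (hcommR w').2
        · rcases Finset.mem_insert.mp hw' with h | h
          · cases h; exact hfin
          · have hne' : w' ≠ w := fun e => hi (e ▸ h)
            exact (hCF w' h).map (hcommC w' hne').1 (hcommC w' hne').2 (hcommRot w' hne')
        · have hne' : w' ≠ w := fun e => hw' (Finset.mem_insert.mpr (Or.inl (by rw [e])))
          exact (hCW w' fun h => hw' (Finset.mem_insert_of_mem h)).map (hcommC w' hne').1 (hcommC w' hne').2
        · rcases Finset.mem_insert.mp hw' with h | h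
          · cases h; exact htw
          · exact htriv w' h
  obtain ⟨e, he, he0, hRF, -, hCF, -, htriv⟩ := key Finset.univ
  exact ⟨e, he, he0, fun w => hRF w (Finset.mem_univ _), fun w => hCF w (Finset.mem_univ _), fun w => htriv w (Finset.mem_univ _)⟩

end Construction

/-! ### 6. The string relation at a complex place -/

section StringRelation

variable {hcpt : isCompact_glFiniteIntegralLevel 2 K}
  {E : Type*} [NormedAddCommGroup E] [InnerProductSpace ℂ E] [CompleteSpace E]
  {τ : ContRepresentation ℂ (AutomorphyDatum.gl 2 K hcpt).arch.carrier E}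
  (hτ : τ.IsStronglyContinuous) (w : {w : InfinitePlace K // IsComplex w})

local notation "𝐜" => ((0, Pi.single w 1) : mixedSpace K)
local notation "𝐜I" => ((0, Pi.single w Complex.I) : mixedSpace K)
local notation "Hc" => Matrix.single (0 : Fin 2) (0 : Fin 2) ((0, Pi.single w 1) : mixedSpace K)
local notation "D" => gardingEnd (hcpt := hcpt) (τ := τ) hτ
local notation "A[" y "]" => gardingAct (hcpt := hcpt) (τ := τ) hτ (expGL ((y : ℝ) • Hc))
local notation "Dh[" i "," j "]" => (gardingEnd (hcpt := hcpt) (τ := τ) hτ (Matrix.single (i : Fin 2) (j : Fin 2) ((0, Pi.single w 1) : mixedSpace K)) -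
  Complex.I • gardingEnd (hcpt := hcpt) (τ := τ) hτ (Matrix.single (i : Fin 2) (j : Fin 2) ((0, Pi.single w Complex.I) : mixedSpace K)))
local notation "Da[" i "," j "]" => (gardingEnd (hcpt := hcpt) (τ := τ) hτ (Matrix.single (i : Fin 2) (j : Fin 2) ((0, Pi.single w 1) : mixedSpace K)) +
  Complex.I • gardingEnd (hcpt := hcpt) (τ := τ) hτ (Matrix.single (i : Fin 2) (j : Fin 2) ((0, Pi.single w Complex.I) : mixedSpace K)))
local notation "Tc" => (Matrix.single (0 : Fin 2) (0 : Fin 2) ((0, Pi.single w Complex.I) : mixedSpace K) -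
  Matrix.single (1 : Fin 2) (1 : Fin 2) ((0, Pi.single w Complex.I) : mixedSpace K))
local notation "Zc" => (Matrix.single (0 : Fin 2) (0 : Fin 2) ((0, Pi.single w Complex.I) : mixedSpace K) +
  Matrix.single (1 : Fin 2) (1 : Fin 2) ((0, Pi.single w Complex.I) : mixedSpace K))

variable {hτ w} (hτu : τ.IsUnitary) (hτi : τ.IsTopIrreducible) {ℓ : archGardingSpace hcpt τ →ₗ[ℂ] ℂ}
  (hℓW : IsArchContWhittakerFunctional hcpt τ hτ ℓ) (hne : ℓ ≠ 0)
include hτu hτi hℓW hne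

/-- **The minimal-type relation between the two Casimir scalars** at a complex place where a non-zero `K_∞`-finite
highest vector of torus weight `m ≥ 2` is killed by the descent operator
(`ArchKTypeDescentKirillovGL2Complex.minimalType_of_apply_gardingAct_descent_eq_zero`, applied to a torus translate
whose radial Kirillov function does not vanish), with the sign of `ν` normalised. [cite: JacquetLanglands1970, §6 Thm. 6.2] -/
theorem exists_string_relation {μ₁ μ₂ lama lamh : ℂ}
    (hZ1 : ∀ v : archGardingSpace hcpt τ, D (Matrix.single 0 0 𝐜 + Matrix.single 1 1 𝐜) v = μ₁ • v)
    (hZ2 : ∀ v : archGardingSpace hcpt τ, D Zc v = μ₂ • v)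
    (hCa : ∀ v : archGardingSpace hcpt τ, ∑ i : Fin 2, ∑ j : Fin 2, Da[i,j] (Da[j,i] v) = lama • v)
    (hCh : ∀ v : archGardingSpace hcpt τ, ∑ i : Fin 2, ∑ j : Fin 2, Dh[i,j] (Dh[j,i] v) = lamh • v)
    {x : archGardingSpace hcpt τ} (hx : x ∈ archKFinite hτ) (hx0 : x ≠ 0) {m : ℕ} (hraw : ComplexRaw hτ w x m) (hm : 2 ≤ m) :
    ∃ ν : ℂ, lama = (μ₁ + Complex.I * μ₂) ^ 2 / 2 - 2 * ν ^ 2 - 2 ∧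
      lamh = (μ₁ - Complex.I * μ₂) ^ 2 / 2 - 2 * (ν - Complex.I * m) ^ 2 - 2 := by
  obtain ⟨hτb, hℓ, hθ₁, hθ₂, ha, hθa⟩ := complexPlace_hyps w hτu hℓW
  -- a square root `ν₀` of the antiholomorphic Casimir relation
  set ν₀ : ℂ := (((μ₁ + Complex.I * μ₂) ^ 2 / 2 - 2 - lama) / 2) ^ (((2 : ℕ) : ℂ)⁻¹) with hν₀
  have hlama : lama = (μ₁ + Complex.I * μ₂) ^ 2 / 2 - 2 * ν₀ ^ 2 - 2 := by
    have h : ν₀ ^ 2 = ((μ₁ + Complex.I * μ₂) ^ 2 / 2 - 2 - lama) / 2 := Complex.cpow_nat_inv_pow _ two_ne_zero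
    rw [h]; ring
  -- a torus translate with non-vanishing radial Kirillov function
  obtain ⟨u, hu⟩ : ∃ u : (mixedSpace K)ˣ, kirillovFn hτ ℓ x u ≠ 0 := by
    by_contra hcon
    push Not at hcon
    exact not_mem_kirillovNull_of_mem_archKFinite hτ hτu hτi hℓW hne hx hx0 hcon
  set u' : (mixedSpace K)ˣ := u * (complexUnitAt K w (unitsSndAt u w))⁻¹ with hu'
  have hu'w : (u' : mixedSpace K).2 w = 1 := by
    rw [hu', coe_mul_complexUnitAt_inv]; exact Function.update_self _ _ _
  set x' : archGardingSpace hcpt τ := gardingAct hτ (diagGL2 u' 1) x with hx'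
  have hraw' : ComplexRaw hτ w x' m :=
    hraw.map (fun i j => commute_gardingAct_diagGL2_lettersC w hu'w 1 i j) (fun i j => commute_gardingAct_diagGL2_lettersC w hu'w Complex.I i j)
  have hxA : ∃ y : ℝ, ℓ (A[y] x') ≠ 0 := by
    refine ⟨Real.log ‖((unitsSndAt u w : ℂˣ) : ℂ)‖, fun h0 => hu ?_⟩
    rw [kirillovFn_eq_complexUnitAt hτ ℓ x w u, ← hx', diagGL2_complexUnitAt, gardingAct_mul, Module.End.mul_apply,
      gardingAct_expGL_cornerI_eq_exp_smul w hraw'.torus (hZ2 x'), map_smul, map_smul, h0, smul_zero]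
  have hmc : (m : ℂ) ≠ 0 := by exact_mod_cast (show m ≠ 0 by omega)
  have hmc1 : (m : ℂ) - 1 ≠ 0 := by
    have : ((m : ℕ) : ℂ) - 1 = ((m - 1 : ℕ) : ℂ) := by push_cast [show 1 ≤ m by omega]; ring
    rw [this]; exact_mod_cast (show m - 1 ≠ 0 by omega)
  have hdesc : ∀ y : ℝ, ℓ (A[y] ((Dh[1,0] + Da[0,1]) x' -
      (1 / (4 * (m : ℂ))) • ((2 : ℂ) • (Dh[0,0] - Dh[1,1]) + (2 : ℂ) • (Da[0,0] - Da[1,1])) ((Dh[1,0] - Da[0,1]) x') -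
      (1 / (4 * (m : ℂ) * ((m : ℂ) - 1))) • (Dh[0,1] + Da[1,0]) ((Dh[1,0] - Da[0,1]) ((Dh[1,0] - Da[0,1]) x')))) = 0 := by
    intro y
    rw [← descentOp_apply hτ w (m : ℂ) x', hraw'.descent hm, map_zero, map_zero]
  rcases minimalType_of_apply_gardingAct_descent_eq_zero hτ w hτb hℓ hθ₁ hθ₂ ha hθa μ₁ μ₂ m hmc hmc1 lama lamh ν₀ hlama x'
      hraw'.raising hraw'.torus hZ1 hZ2 (hCa x') hCh hdesc hxA with h | h
  · exact ⟨ν₀, hlama, h⟩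
  · refine ⟨-ν₀, by rw [neg_sq]; exact hlama, ?_⟩
    rw [h]; ring

end StringRelation

/-! ### 7. Tags, shape functions, rigidity of the Kirillov function of the test vector -/

/-- The four final real types, as data. [cite: JacquetLanglands1970, §5 Thm. 5.15] -/
inductive RealTag
  | discPlus (k : ℕ)
  | weightOneSym (κ : ℂ)
  | weightZero
  | weightZeroX

/-- The three final complex types, as data. [cite: JacquetLanglands1970, §6 Thm. 6.4] -/
inductive ComplexTag
  | holPow (b : ℕ)
  | antiPowLowest (b : ℕ)
  | string (j : ℕ)

section Tags

variable {hcpt : isCompact_glFiniteIntegralLevel 2 K}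
  {E : Type*} [NormedAddCommGroup E] [InnerProductSpace ℂ E] [CompleteSpace E]
  {τ : ContRepresentation ℂ (AutomorphyDatum.gl 2 K hcpt).arch.carrier E}
  (hτ : τ.IsStronglyContinuous)

/-- The real type with a given tag. [folklore] -/
def RealTagged (w : {w : InfinitePlace K // IsReal w}) (δ : GL (Fin 2) (mixedSpace K)) (μ lam : ℂ) :
    RealTag → archGardingSpace hcpt τ → Prop
  | .discPlus k, v => 1 ≤ k ∧ RealDiscPlus hτ w v k μ
  | .weightOneSym κ, v => RealWeightOneSym hτ w δ v 1 κ μ lam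
  | .weightZero, v => RealWeightZero hτ w δ v 1 μ lam
  | .weightZeroX, v => RealWeightZeroX hτ w δ v 1 μ lam

/-- The complex type with a given tag (including the torus condition `it + μ₂ = 0`). [folklore] -/
def ComplexTagged (w : {w : InfinitePlace K // IsComplex w}) (m : ℕ) (μ₂ : ℂ) : ComplexTag → archGardingSpace hcpt τ → Prop
  | .holPow b, v => ComplexHolPow hτ w v b m ∧ Complex.I * ((m : ℂ) + 2 * b) + μ₂ = 0
  | .antiPowLowest b, v => ComplexAntiPowLowest hτ w v b m ∧ Complex.I * (-(m : ℂ) - 2 * b) + μ₂ = 0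
  | .string j, v => 0 < j ∧ j < m ∧ ComplexString hτ w v j m ∧ Complex.I * ((m : ℂ) - 2 * j) + μ₂ = 0

variable {hτ}

/-- A real final vector has a tag. [folklore] -/
theorem exists_realTag {w : {w : InfinitePlace K // IsReal w}} {δ : GL (Fin 2) (mixedSpace K)} {μ lam : ℂ}
    {v : archGardingSpace hcpt τ} (h : RealFinal hτ w δ μ lam v) : ∃ t : RealTag, RealTagged hτ w δ μ lam t v := by
  rcases h with ⟨k, hk, h⟩ | ⟨κ, h⟩ | h | h
  · exact ⟨.discPlus k, hk, h⟩
  · exact ⟨.weightOneSym κ, h⟩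
  · exact ⟨.weightZero, h⟩
  · exact ⟨.weightZeroX, h⟩

/-- A complex final vector has a tag. [folklore] -/
theorem exists_complexTag {w : {w : InfinitePlace K // IsComplex w}} {m : ℕ} {μ₂ : ℂ}
    {v : archGardingSpace hcpt τ} (h : ComplexFinal hτ w m μ₂ v) : ∃ t : ComplexTag, ComplexTagged hτ w m μ₂ t v := by
  rcases h with ⟨b, h, hb⟩ | ⟨b, h, hb⟩ | ⟨j, hj, hjm, h, hb⟩
  · exact ⟨.holPow b, h, hb⟩
  · exact ⟨.antiPowLowest b, h, hb⟩
  · exact ⟨.string j, hj, hjm, h, hb⟩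

/-- Transport of tagged real types. [folklore] -/
theorem RealTagged.map {w : {w : InfinitePlace K // IsReal w}} {δ : GL (Fin 2) (mixedSpace K)} {μ lam : ℂ}
    {Φ : Module.End ℂ (archGardingSpace hcpt τ)}
    (hΦ : ∀ i j : Fin 2, Commute Φ (gardingEnd hτ (Matrix.single i j ((Pi.single w 1, 0) : mixedSpace K))))
    (hΦδ : Commute Φ (gardingAct hτ δ)) : ∀ {t : RealTag} {v : archGardingSpace hcpt τ},
    RealTagged hτ w δ μ lam t v → RealTagged hτ w δ μ lam t (Φ v)
  | .discPlus _, _, ⟨hk, h⟩ => ⟨hk, h.map w hΦ⟩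
  | .weightOneSym _, _, h => RealWeightOneSym.map w hΦ hΦδ h
  | .weightZero, _, h => RealWeightZero.map w hΦ hΦδ h
  | .weightZeroX, _, h => RealWeightZeroX.map w hΦ hΦδ h

/-- Transport of tagged complex types. [folklore] -/
theorem ComplexTagged.map {w : {w : InfinitePlace K // IsComplex w}} {m : ℕ} {μ₂ : ℂ} {Φ : Module.End ℂ (archGardingSpace hcpt τ)}
    (h1 : ∀ i j : Fin 2, Commute Φ (gardingEnd hτ (Matrix.single i j ((0, Pi.single w 1) : mixedSpace K))))
    (h2 : ∀ i j : Fin 2, Commute Φ (gardingEnd hτ (Matrix.single i j ((0, Pi.single w Complex.I) : mixedSpace K))))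
    (hR : Commute Φ (gardingAct hτ (expGL ((Real.pi / 2 : ℝ) •
      (Matrix.single (0 : Fin 2) (1 : Fin 2) ((0, Pi.single w 1) : mixedSpace K) - Matrix.single (1 : Fin 2) (0 : Fin 2) ((0, Pi.single w 1) : mixedSpace K)))))) :
    ∀ {t : ComplexTag} {v : archGardingSpace hcpt τ}, ComplexTagged hτ w m μ₂ t v → ComplexTagged hτ w m μ₂ t (Φ v)
  | .holPow _, _, ⟨h, hb⟩ => ⟨h.map w h1 h2 hR, hb⟩
  | .antiPowLowest _, _, ⟨h, hb⟩ => ⟨h.map w h1 h2 hR, hb⟩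
  | .string _, _, ⟨hj, hjm, h, hb⟩ => ⟨hj, hjm, h.map w h1 h2 hR, hb⟩

/-! #### Shape functions -/

/-- The shape function on `ℝˣ` of a real tag (`μ` the central scalar, `ν` the Bessel parameter of the place):
`realShapeFn 0 1 (u^{(μ+k)/2} e^{-2πu})`, `realShapeFn 1 1 (u^{(μ+1)/2} k_{i(κ-1/2)})`, `realShapeFn 1 1 (u^{μ/2} k_ν)`,
`realShapeFn 1 1 (u^{μ/2+1} k_ν)`. [cite: JacquetLanglands1970, §5 Thm. 5.15] -/
def realShapeOf (μ ν : ℂ) : RealTag → ℝ → ℂ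
  | .discPlus k => realShapeFn 0 1 (expShape ((μ + k) / 2) (2 * Real.pi))
  | .weightOneSym κ => realShapeFn 1 1 (besselShape ((μ + 1) / 2) (2 * Real.pi) (Complex.I * (κ - 1 / 2)))
  | .weightZero => realShapeFn 1 1 (besselShape (μ / 2) (2 * Real.pi) ν)
  | .weightZeroX => realShapeFn 1 1 (besselShape (μ / 2 + 1) (2 * Real.pi) ν)

/-- The radial shape function of a complex tag: `|z|^β k_{ν''}(|z|)` (`k = besselMode 4π`).
[cite: JacquetLanglands1970, §6 Thm. 6.4] -/
def complexShapeOf (μ₁ : ℂ) (m : ℕ) (ν ν' : ℂ) : ComplexTag → ℂ → ℂ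
  | .holPow b => fun z => besselShape ((μ₁ + m + 1) / 2 + b) (4 * Real.pi) ν ‖z‖
  | .antiPowLowest b => fun z => besselShape ((μ₁ + m + 1) / 2 + b) (4 * Real.pi) ν' ‖z‖
  | .string j => fun z => besselShape ((μ₁ + m + 1) / 2) (4 * Real.pi) (ν - Complex.I * j) ‖z‖

/-- The real shape functions are measurable. [folklore] -/
theorem measurable_realShapeOf (μ ν : ℂ) (t : RealTag) : Measurable (realShapeOf μ ν t) := by
  have h2π : (0 : ℝ) < 2 * Real.pi := by positivity
  cases t with
  | discPlus k => exact measurable_realShapeFn 0 1 (continuousOn_expShape ((μ + k) / 2) (2 * Real.pi))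
  | weightOneSym κ => exact measurable_realShapeFn 1 1 (continuousOn_besselShape ((μ + 1) / 2) h2π (Complex.I * (κ - 1 / 2)))
  | weightZero => exact measurable_realShapeFn 1 1 (continuousOn_besselShape (μ / 2) h2π ν)
  | weightZeroX => exact measurable_realShapeFn 1 1 (continuousOn_besselShape (μ / 2 + 1) h2π ν)

/-- A radial function `z ↦ H(|z|)` with `H` continuous on `(0,∞)` is measurable on `ℂ`. [folklore] -/
theorem measurable_radial {H : ℝ → ℂ} (hH : ContinuousOn H (Ioi 0)) : Measurable fun z : ℂ => H ‖z‖ := by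
  refine measurable_of_continuousOn_compl_singleton 0 fun z hz => ?_
  have hz' : 0 < ‖z‖ := norm_pos_iff.mpr hz
  exact ((hH.continuousAt (isOpen_Ioi.mem_nhds hz')).comp continuous_norm.continuousAt).continuousWithinAt

/-- The complex shape functions are measurable. [folklore] -/
theorem measurable_complexShapeOf (μ₁ : ℂ) (m : ℕ) (ν ν' : ℂ) (t : ComplexTag) : Measurable (complexShapeOf μ₁ m ν ν' t) := by
  have h4π : (0 : ℝ) < 4 * Real.pi := by positivity
  cases t with
  | holPow b => exact measurable_radial (continuousOn_besselShape ((μ₁ + m + 1) / 2 + b) h4π ν)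
  | antiPowLowest b => exact measurable_radial (continuousOn_besselShape ((μ₁ + m + 1) / 2 + b) h4π ν')
  | string j => exact measurable_radial (continuousOn_besselShape ((μ₁ + m + 1) / 2) h4π (ν - Complex.I * j))

/-- **Mellin transforms of the real shape functions are Gamma products.** [cite: JacquetLanglands1970, §5 Thm. 5.15] -/
theorem mellin_realShapeOf (μ ν : ℂ) (t : RealTag) : ∃ x₀ : ℝ,
    (∀ s : ℂ, x₀ < s.re → Integrable fun u : ℝ => realShapeOf μ ν t u * ((|u| : ℝ) : ℂ) ^ (s - 3 / 2)) ∧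
    IsGammaProduct x₀ (fun s => ∫ u : ℝ, realShapeOf μ ν t u * ((|u| : ℝ) : ℂ) ^ (s - 3 / 2)) := by
  have h2π : (0 : ℝ) < 2 * Real.pi := by positivity
  have h01 : (0 : ℂ) + 1 ≠ 0 := by norm_num
  have h11 : (1 : ℂ) + 1 ≠ 0 := by norm_num
  cases t with
  | discPlus k => exact ⟨_, isGammaProduct_mellin_expShape h2π ((μ + k) / 2) h01⟩
  | weightOneSym κ => exact ⟨_, isGammaProduct_mellin_besselShape h2π ((μ + 1) / 2) (Complex.I * (κ - 1 / 2)) h11⟩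
  | weightZero => exact ⟨_, isGammaProduct_mellin_besselShape h2π (μ / 2) ν h11⟩
  | weightZeroX => exact ⟨_, isGammaProduct_mellin_besselShape h2π (μ / 2 + 1) ν h11⟩

/-- **Mellin transforms over `ℂ` of the complex shape functions are Gamma products.** [cite: JacquetLanglands1970, §6 Thm. 6.4] -/
theorem mellin_complexShapeOf (μ₁ : ℂ) (m : ℕ) (ν ν' : ℂ) (t : ComplexTag) : ∃ x₀ : ℝ,
    (∀ s : ℂ, x₀ < s.re → Integrable fun z : ℂ => complexShapeOf μ₁ m ν ν' t z * ((‖z‖ ^ 2 : ℝ) : ℂ) ^ (s - 3 / 2)) ∧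
    IsGammaProduct x₀ (fun s => ∫ z : ℂ, complexShapeOf μ₁ m ν ν' t z * ((‖z‖ ^ 2 : ℝ) : ℂ) ^ (s - 3 / 2)) := by
  have h4π : (0 : ℝ) < 4 * Real.pi := by positivity
  cases t with
  | holPow b => exact ⟨_, isGammaProduct_mellin_complexBesselShape h4π ((μ₁ + m + 1) / 2 + b) ν⟩
  | antiPowLowest b => exact ⟨_, isGammaProduct_mellin_complexBesselShape h4π ((μ₁ + m + 1) / 2 + b) ν'⟩
  | string j => exact ⟨_, isGammaProduct_mellin_complexBesselShape h4π ((μ₁ + m + 1) / 2) (ν - Complex.I * j)⟩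

/-! #### The Kirillov function of a tagged vector -/

variable (hτu : τ.IsUnitary) (hτi : τ.IsTopIrreducible) {ℓ : archGardingSpace hcpt τ →ₗ[ℂ] ℂ}
  (hℓW : IsArchContWhittakerFunctional hcpt τ hτ ℓ)
include hτu hℓW

/-- **The Kirillov function on `ℝˣ` of a tagged real vector is a multiple of the shape function of the tag.**
[cite: JacquetLanglands1970, §5 Thm. 5.15] -/
theorem RealTagged.kirillov {w : {w : InfinitePlace K // IsReal w}} {δ : GL (Fin 2) (mixedSpace K)}
    (hδ : (δ : Matrix (Fin 2) (Fin 2) (mixedSpace K)) = 1 - (2 : ℝ) • Matrix.single (0 : Fin 2) (0 : Fin 2) ((Pi.single w 1, 0) : mixedSpace K))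
    {μ lam : ℂ} (ν : ℂ) (hlam : lam = μ ^ 2 / 2 - 2 * ν ^ 2 - 1 / 2) {t : RealTag} {v : archGardingSpace hcpt τ}
    (h : RealTagged hτ w δ μ lam t v) :
    ∃ c : ℂ, ∀ x : ℝˣ, ℓ (gardingAct hτ (diagGL2 (realUnitAt K w x) 1) v) = c * realShapeOf μ ν t x := by
  cases t with
  | discPlus k =>
    refine h.2.kirillov w hδ hτu hℓW (fun x hx => ?_) (fun x hx => ?_)
    · rw [realShapeOf, realShapeFn_of_pos _ _ _ hx, zero_mul]
    · rw [realShapeOf, realShapeFn_of_neg _ _ _ hx, one_mul, expShape]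
  | weightOneSym κ =>
    refine RealWeightOneSym.kirillov w hδ hτu hℓW h (fun x hx => ?_) (fun x hx => ?_)
    · rw [realShapeOf, realShapeFn_of_pos _ _ _ hx, one_mul, besselShape]
    · rw [realShapeOf, realShapeFn_of_neg _ _ _ hx, besselShape]
  | weightZero =>
    refine RealWeightZero.kirillov w hδ hτu hℓW h ν hlam (fun x hx => ?_) (fun x hx => ?_)
    · rw [realShapeOf, realShapeFn_of_pos _ _ _ hx, one_mul, besselShape]
    · rw [realShapeOf, realShapeFn_of_neg _ _ _ hx, besselShape]
  | weightZeroX =>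
    refine RealWeightZeroX.kirillov w hδ hτu hℓW h ν hlam (fun x hx => ?_) (fun x hx => ?_)
    · rw [realShapeOf, realShapeFn_of_pos _ _ _ hx, one_mul, besselShape]
    · rw [realShapeOf, realShapeFn_of_neg _ _ _ hx, besselShape]

/-- **The Kirillov function on `ℂˣ` of a tagged complex vector is a multiple of the shape function of the tag**
(the compact torus acts trivially as `it + μ₂ = 0`). [cite: JacquetLanglands1970, §6 Thm. 6.4] -/
theorem ComplexTagged.kirillov {w : {w : InfinitePlace K // IsComplex w}} {m : ℕ} {μ₁ μ₂ lama lamh ν ν' : ℂ}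
    (hlama : lama = (μ₁ + Complex.I * μ₂) ^ 2 / 2 - 2 * ν ^ 2 - 2)
    (hlamh : lamh = (μ₁ - Complex.I * μ₂) ^ 2 / 2 - 2 * ν' ^ 2 - 2)
    (hZ1 : ∀ v : archGardingSpace hcpt τ, gardingEnd hτ (Matrix.single 0 0 ((0, Pi.single w 1) : mixedSpace K) +
      Matrix.single 1 1 ((0, Pi.single w 1) : mixedSpace K)) v = μ₁ • v)
    (hZ2 : ∀ v : archGardingSpace hcpt τ, gardingEnd hτ (Matrix.single 0 0 ((0, Pi.single w Complex.I) : mixedSpace K) +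
      Matrix.single 1 1 ((0, Pi.single w Complex.I) : mixedSpace K)) v = μ₂ • v)
    (hCa : ∀ v : archGardingSpace hcpt τ, ∑ i : Fin 2, ∑ j : Fin 2,
      (gardingEnd hτ (Matrix.single i j ((0, Pi.single w 1) : mixedSpace K)) + Complex.I • gardingEnd hτ (Matrix.single i j ((0, Pi.single w Complex.I) : mixedSpace K)))
        ((gardingEnd hτ (Matrix.single j i ((0, Pi.single w 1) : mixedSpace K)) + Complex.I • gardingEnd hτ (Matrix.single j i ((0, Pi.single w Complex.I) : mixedSpace K))) v) = lama • v)
    (hCh : ∀ v : archGardingSpace hcpt τ, ∑ i : Fin 2, ∑ j : Fin 2,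
      (gardingEnd hτ (Matrix.single i j ((0, Pi.single w 1) : mixedSpace K)) - Complex.I • gardingEnd hτ (Matrix.single i j ((0, Pi.single w Complex.I) : mixedSpace K)))
        ((gardingEnd hτ (Matrix.single j i ((0, Pi.single w 1) : mixedSpace K)) - Complex.I • gardingEnd hτ (Matrix.single j i ((0, Pi.single w Complex.I) : mixedSpace K))) v) = lamh • v)
    (hrel : ∀ j : ℕ, 0 < j → j < m → lamh = (μ₁ - Complex.I * μ₂) ^ 2 / 2 - 2 * (ν - Complex.I * m) ^ 2 - 2)
    {t : ComplexTag} {v : archGardingSpace hcpt τ} (h : ComplexTagged hτ w m μ₂ t v) :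
    ∃ c : ℂ, ∀ z : ℂˣ, ℓ (gardingAct hτ (diagGL2 (complexUnitAt K w z) 1) v) = c * complexShapeOf μ₁ m ν ν' t z := by
  cases t with
  | holPow b =>
    obtain ⟨hT, c, hc⟩ := h.1.radial w hτu hℓW μ₁ μ₂ lama ν hlama hZ1 hZ2 hCa
    refine ⟨c, fun z => ?_⟩
    rw [kirillovC_eq_of_radial w hT (hZ2 v) (Φ := fun x : ℝ => (x : ℂ) ^ ((μ₁ + m + 1) / 2 + b) * besselMode (4 * Real.pi) ν x) hc, h.2,
      zero_div, zero_mul, Complex.exp_zero, mul_one]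
    rfl
  | antiPowLowest b =>
    obtain ⟨hT, c, hc⟩ := h.1.radial w hτu hℓW μ₁ μ₂ lamh ν' hlamh hZ1 hZ2 hCh
    refine ⟨c, fun z => ?_⟩
    rw [kirillovC_eq_of_radial w hT (hZ2 v) (Φ := fun x : ℝ => (x : ℂ) ^ ((μ₁ + m + 1) / 2 + b) * besselMode (4 * Real.pi) ν' x) hc, h.2,
      zero_div, zero_mul, Complex.exp_zero, mul_one]
    rfl
  | string j =>
    obtain ⟨hj, hjm, hs, hb⟩ := h
    obtain ⟨hT, c, hc⟩ := hs.radial w hτu hℓW μ₁ μ₂ lama lamh ν hlama (hrel j hj hjm) hZ1 hZ2 hCa hCh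
    refine ⟨c, fun z => ?_⟩
    rw [kirillovC_eq_of_radial w hT (hZ2 v) (Φ := fun x : ℝ => (x : ℂ) ^ ((μ₁ + m + 1) / 2) * besselMode (4 * Real.pi) (ν - Complex.I * j) x) hc,
      hb, zero_div, zero_mul, Complex.exp_zero, mul_one]
    rfl

/-- **Rigidity at a real place of the Kirillov function of a vector with a tagged final type there.**
[cite: JacquetLanglands1970, §5 Thm. 5.15] -/
theorem RealTagged.rigid {w : {w : InfinitePlace K // IsReal w}} {δ : GL (Fin 2) (mixedSpace K)}
    (hδ : (δ : Matrix (Fin 2) (Fin 2) (mixedSpace K)) = 1 - (2 : ℝ) • Matrix.single (0 : Fin 2) (0 : Fin 2) ((Pi.single w 1, 0) : mixedSpace K))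
    {μ lam : ℂ} (ν : ℂ) (hlam : lam = μ ^ 2 / 2 - 2 * ν ^ 2 - 1 / 2) {t : RealTag} {e : archGardingSpace hcpt τ}
    (h : RealTagged hτ w δ μ lam t e) : RigidRealAt (kirillovFn hτ ℓ e) w (realShapeOf μ ν t) :=
  rigidRealAt_kirillovFn hτ ℓ fun u' hu' =>
    RealTagged.kirillov hτu hℓW hδ ν hlam (h.map (fun i j => commute_gardingAct_diagGL2_letters w hu' i j) (commute_gardingAct_diagGL2_realSign w hδ u'))

/-- **Rigidity at a complex place.** [cite: JacquetLanglands1970, §6 Thm. 6.4] -/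
theorem ComplexTagged.rigid {w : {w : InfinitePlace K // IsComplex w}} {m : ℕ} {μ₁ μ₂ lama lamh ν ν' : ℂ}
    (hlama : lama = (μ₁ + Complex.I * μ₂) ^ 2 / 2 - 2 * ν ^ 2 - 2)
    (hlamh : lamh = (μ₁ - Complex.I * μ₂) ^ 2 / 2 - 2 * ν' ^ 2 - 2)
    (hZ1 : ∀ v : archGardingSpace hcpt τ, gardingEnd hτ (Matrix.single 0 0 ((0, Pi.single w 1) : mixedSpace K) +
      Matrix.single 1 1 ((0, Pi.single w 1) : mixedSpace K)) v = μ₁ • v)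
    (hZ2 : ∀ v : archGardingSpace hcpt τ, gardingEnd hτ (Matrix.single 0 0 ((0, Pi.single w Complex.I) : mixedSpace K) +
      Matrix.single 1 1 ((0, Pi.single w Complex.I) : mixedSpace K)) v = μ₂ • v)
    (hCa : ∀ v : archGardingSpace hcpt τ, ∑ i : Fin 2, ∑ j : Fin 2,
      (gardingEnd hτ (Matrix.single i j ((0, Pi.single w 1) : mixedSpace K)) + Complex.I • gardingEnd hτ (Matrix.single i j ((0, Pi.single w Complex.I) : mixedSpace K)))
        ((gardingEnd hτ (Matrix.single j i ((0, Pi.single w 1) : mixedSpace K)) + Complex.I • gardingEnd hτ (Matrix.single j i ((0, Pi.single w Complex.I) : mixedSpace K))) v) = lama • v)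
    (hCh : ∀ v : archGardingSpace hcpt τ, ∑ i : Fin 2, ∑ j : Fin 2,
      (gardingEnd hτ (Matrix.single i j ((0, Pi.single w 1) : mixedSpace K)) - Complex.I • gardingEnd hτ (Matrix.single i j ((0, Pi.single w Complex.I) : mixedSpace K)))
        ((gardingEnd hτ (Matrix.single j i ((0, Pi.single w 1) : mixedSpace K)) - Complex.I • gardingEnd hτ (Matrix.single j i ((0, Pi.single w Complex.I) : mixedSpace K))) v) = lamh • v)
    (hrel : ∀ j : ℕ, 0 < j → j < m → lamh = (μ₁ - Complex.I * μ₂) ^ 2 / 2 - 2 * (ν - Complex.I * m) ^ 2 - 2)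
    {t : ComplexTag} {e : archGardingSpace hcpt τ} (h : ComplexTagged hτ w m μ₂ t e) :
    RigidComplexAt (kirillovFn hτ ℓ e) w (complexShapeOf μ₁ m ν ν' t) :=
  rigidComplexAt_kirillovFn hτ ℓ fun _ hu' =>
    ComplexTagged.kirillov hτu hℓW hlama hlamh hZ1 hZ2 hCa hCh hrel
      (h.map (fun i j => commute_gardingAct_diagGL2_lettersC w hu' 1 i j) (fun i j => commute_gardingAct_diagGL2_lettersC w hu' Complex.I i j)
        (commute_gardingAct_diagGL2_weylRotC w hu'))

end Tags

end Literature.NumberTheory.Automorphic
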